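import Mathlib
import Literature.NumberTheory.Automorphic.InvariantIntegralOperators
import Literature.NumberTheory.Automorphic.InvariantLaplacian

/-!
# Eigenfunctions of `Δ` are eigenfunctions of all invariant integral operators (Theorems 1.14–1.16)
(Iwaniec, *Spectral Methods of Automorphic Forms*, GSM 53, §1.3 (1.16), §1.6 (1.20), §1.8
Lemmas 1.10–1.12, Corollary 1.13, Theorems 1.14 and 1.16, PDF pp. 15–16, 22–24)

Twelfth layer of the `provefact` decomposition of `Literature.NumberTheory.Automorphic.sl2BallCount_asymp`
(`HyperbolicLatticeCount.lean`) and the third brick of the spectral theory of `L²(SL₂(ℤ)\\ℍ)`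
behind the remaining named fact `Iwaniec2002_thm_7_4_modular` (`ModularPretrace.lean`): the
projections `⟨K(·, w), u_j⟩ = h(t_j) ū_j(w)` of an automorphic kernel on the eigenfunctions
(Theorem 7.4) rest on Theorem 1.16, `∫_ℍ k(u(z, w)) f(w) dμ(w) = h(t) f(z)` for every eigenfunction
`(Δ + 1/4 + t²) f = 0`. Everything here is proved; nothing is vendored.

1. The rotations `k(θ) ∈ SL₂(ℝ)` (stability group of `i`), their orbit derivative `-(1 + z²)`, the
   points `i e^r` and geodesic polar coordinates about `i` ((1.16): every `z` is `k(φ)(i e^r)`).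
2. The mean-value operator `(rotAvg f)(z) = ∫_0^π f(k(θ)z) dθ` (`= π f_i(z)` in the book's
   normalisation): invariance under `K` and radiality (Lemma 1.10), `(rotAvg f)(i) = π f(i)` ((1.57)).
3. Calculus in polar coordinates: `g(r, φ) = f(k(φ)(i e^r))` is `C²` for `f ∈ C²(ℍ)`, its partials
   through the rotated functions `f ∘ k(φ)`, and **(1.20) in divergence form**:
   `cosh r ∂_r g + sinh r ∂_r² g + (4 sinh r)⁻¹ ∂_φ² g = sinh r · (Δf)(k(φ)(i e^r))`
   (`polarLaplacian_identity`; from the invariance of `Δ`, `InvariantLaplacian.lean`).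
4. Green's identity on the annuli `ε ≤ ρ(z, i) ≤ R` (Mathlib's divergence theorem on the box
   `[ε, R] × [0, π]`, the `φ`-boundary cancelling by `π`-periodicity) and `ε → 0`: for an
   eigenfunction `(Δ + λ)f = 0`, `sinh R · F̃'(R) = -λ ∫_0^R sinh r F̃(r) dr` with
   `F̃(r) = (rotAvg f)(i e^r)` (`radial_identity`) — the radial equation of Lemma 1.12, integrated.
5. **Uniqueness** (Lemma 1.12 / Corollary 1.13 in the form used): if moreover `f(i) = 0` then
   `rotAvg f ≡ 0` on `ℍ` (`rotAvg_eq_zero`; Gronwall's inequality instead of the hypergeometric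
   equation (1.44)).
6. **Lemma 1.11** `L_k(rotAvg f)(i) = π (L_k f)(i)` (Fubini and the invariance of `L_k`) and
   **Theorems 1.14 & 1.16**: `invariantOperator k f z = selbergTransform k t * f z` for every test
   kernel `k` (bounded, compactly supported; the book takes `k ∈ C_0^∞(ℝ⁺)`), every `f ∈ C²(ℍ)` with
   `(Δ + 1/4 + t²) f = 0`, `t ∈ ℂ`, and every `z` (reduction to `z = i` by transitivity, `f - f(i) y^s`,
   and the value `h(t)` on `y^s` from `InvariantIntegralOperators.lean`).

Mathlib: `Matrix.SpecialLinearGroup`, the isometric `SL(2, ℝ)`-action on `ℍ`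
(`UpperHalfPlane.coe_specialLinearGroup_apply`, `dist_smul`, `MulAction.IsPretransitive`),
`integral2_divergence_prod_of_hasFDerivAt` (divergence theorem on boxes),
`intervalIntegral.hasDerivAt_integral_of_dominated_loc_of_deriv_le`,
`eq_zero_of_abs_deriv_le_mul_abs_self_of_eq_zero_right` (Gronwall), `InnerProductSpace.laplacian`
calculus. Literature: `hypLaplacian`, `IsC2` (`HyperbolicLaplaceSpectrum.lean`),
`hypLaplacian_comp_smul`, `IsC2.comp_smul`, `hypLaplacian_im_cpow` (`InvariantLaplacian.lean`),
`invariantOperator`, `invariantOperator_comp_smul`, `invariantOperator_im_cpow`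
(`InvariantIntegralOperators.lean`). Neither the rotations `k(θ)`, geodesic polar coordinates, the
polar form of the hyperbolic Laplacian nor Theorem 1.16 exist in Mathlib or Literature
(`lean search 'rotAvg|polarLaplacian|geodesic polar|SO\\(2\\).*UpperHalfPlane'`).
-/

noncomputable section

namespace Literature.NumberTheory.Automorphic

open MeasureTheory Set Filter Real UpperHalfPlane
open scoped Topology MatrixGroups

/-! ## 1. The rotations `k(θ) ∈ SL₂(ℝ)` fixing `i` -/

/-- The rotation `k(θ) = [[cos θ, -sin θ], [sin θ, cos θ]] ∈ K = SO(2) ⊂ SL₂(ℝ)`, the stability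
group of `i` (Iwaniec §1.1–1.2, `K = {k(θ)}`). [cite: Iwaniec2002, §1.2, PDF p. 10] -/
def rot (θ : ℝ) : SL(2, ℝ) :=
  ⟨!![Real.cos θ, -Real.sin θ; Real.sin θ, Real.cos θ], by
    rw [Matrix.det_fin_two_of]
    nlinarith [Real.cos_sq_add_sin_sq θ]⟩

/-- Entry `(0,0)` of `k(θ)` is `cos θ`. [folklore] -/
@[simp] theorem rot_apply_00 (θ : ℝ) : (rot θ) 0 0 = Real.cos θ := rfl
/-- Entry `(0,1)` of `k(θ)` is `-sin θ`. [folklore] -/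
@[simp] theorem rot_apply_01 (θ : ℝ) : (rot θ) 0 1 = -Real.sin θ := rfl
/-- Entry `(1,0)` of `k(θ)` is `sin θ`. [folklore] -/
@[simp] theorem rot_apply_10 (θ : ℝ) : (rot θ) 1 0 = Real.sin θ := rfl
/-- Entry `(1,1)` of `k(θ)` is `cos θ`. [folklore] -/
@[simp] theorem rot_apply_11 (θ : ℝ) : (rot θ) 1 1 = Real.cos θ := rfl

/-- `k(0) = 1`. [folklore] -/
theorem rot_zero : rot 0 = 1 := by
  ext i j
  fin_cases i <;> fin_cases j <;> simp [rot]

/-- `k(a + b) = k(a) k(b)` (addition formulas). [folklore] -/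
theorem rot_add (a b : ℝ) : rot (a + b) = rot a * rot b := by
  ext i j
  fin_cases i <;> fin_cases j <;>
    simp [rot, Matrix.mul_apply, Fin.sum_univ_two, Real.cos_add, Real.sin_add] <;> ring

/-- `k(θ + π) = -k(θ)`. [folklore] -/
theorem rot_add_pi (θ : ℝ) : rot (θ + π) = -rot θ := by
  ext i j
  fin_cases i <;> fin_cases j <;> simp [rot, Real.cos_add_pi, Real.sin_add_pi]

/-- The action of `k(θ)` in coordinates: `k(θ) z = (z cos θ - sin θ)/(z sin θ + cos θ)`. [folklore] -/
theorem coe_rot_smul (θ : ℝ) (z : ℍ) :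
    ((rot θ • z : ℍ) : ℂ) = ((Real.cos θ : ℂ) * z - Real.sin θ) / ((Real.sin θ : ℂ) * z + Real.cos θ) := by
  rw [coe_specialLinearGroup_apply]
  simp [rot]
  ring

/-- The denominator `z sin θ + cos θ` does not vanish on `ℍ`. [folklore] -/
theorem rot_denom_ne_zero (θ : ℝ) (z : ℍ) : (Real.sin θ : ℂ) * z + Real.cos θ ≠ 0 := by
  have h := denom_ne_zero (rot θ : GL (Fin 2) ℝ) z
  simpa [denom, rot] using h

/-- `k(θ)` fixes `i`. [cite: Iwaniec2002, §1.2, PDF p. 10] -/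
theorem rot_smul_I (θ : ℝ) : rot θ • UpperHalfPlane.I = UpperHalfPlane.I := by
  apply UpperHalfPlane.ext
  rw [coe_rot_smul, UpperHalfPlane.coe_I]
  have h : (Real.sin θ : ℂ) * Complex.I + Real.cos θ ≠ 0 := by
    have := rot_denom_ne_zero θ UpperHalfPlane.I
    rwa [UpperHalfPlane.coe_I] at this
  rw [div_eq_iff h]
  ring_nf
  rw [Complex.I_sq]
  ring

/-- `-g ∈ SL₂(ℝ)` acts on `ℍ` as `g`. [folklore] -/
theorem SL2R_neg_smul (g : SL(2, ℝ)) (z : ℍ) : (-g) • z = g • z := by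
  rw [show (-g) • z = ((-g : SL(2, ℝ)) : GL (Fin 2) ℝ) • z from rfl,
    show g • z = ((g : SL(2, ℝ)) : GL (Fin 2) ℝ) • z from rfl]
  have h := UpperHalfPlane.neg_smul ((g : SL(2, ℝ)) : GL (Fin 2) ℝ) z
  rw [← h]
  congr 1
  ext i j
  simp [Matrix.SpecialLinearGroup.toGL]

/-- `k(θ + π)` acts as `k(θ)` (`-1` acts trivially). [folklore] -/
theorem rot_add_pi_smul (θ : ℝ) (z : ℍ) : rot (θ + π) • z = rot θ • z := by
  rw [rot_add_pi, SL2R_neg_smul]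

/-- `θ ↦ k(θ) z` is `π`-periodic. [folklore] -/
theorem periodic_rot_smul (z : ℍ) : Function.Periodic (fun θ => rot θ • z) π :=
  fun θ => rot_add_pi_smul θ z

/-- Composition of rotations on `ℍ`. [folklore] -/
theorem rot_smul_rot_smul (a b : ℝ) (z : ℍ) : rot a • (rot b • z) = rot (a + b) • z := by
  rw [rot_add, mul_smul]

/-- `k(π/2) = S` acts by `z ↦ -1/z`; on the imaginary axis `iy ↦ i/y`. [folklore] -/
theorem rot_pi_div_two_smul_mk_I_mul {y : ℝ} (hy : 0 < y) :
    rot (π / 2) • UpperHalfPlane.mk (Complex.I * y) (by simpa using hy) =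
      UpperHalfPlane.mk (Complex.I * y⁻¹) (by simpa using hy) := by
  apply UpperHalfPlane.ext
  rw [coe_rot_smul]
  simp only [Real.cos_pi_div_two, Real.sin_pi_div_two, Complex.ofReal_zero,
    Complex.ofReal_one, zero_mul, one_mul, zero_sub, add_zero]
  have hy' : (y : ℂ) ≠ 0 := by exact_mod_cast hy.ne'
  have hI : Complex.I * (y : ℂ) ≠ 0 := mul_ne_zero Complex.I_ne_zero hy'
  rw [div_eq_iff hI]
  rw [show Complex.I * ((y⁻¹ : ℝ) : ℂ) * (Complex.I * y) = (Complex.I * Complex.I) * (((y⁻¹ : ℝ) : ℂ) * y) by ring,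
    Complex.I_mul_I, Complex.ofReal_inv, inv_mul_cancel₀ hy']
  ring

/-! ### Continuity and the orbit map -/

/-- Joint continuity of `(θ, z) ↦ k(θ) z` (as a point of `ℂ`). [folklore] -/
theorem continuous_coe_rot_smul :
    Continuous fun p : ℝ × ℍ => ((rot p.1 • p.2 : ℍ) : ℂ) := by
  have e : (fun p : ℝ × ℍ => ((rot p.1 • p.2 : ℍ) : ℂ)) = fun p : ℝ × ℍ =>
      ((Real.cos p.1 : ℂ) * p.2 - Real.sin p.1) / ((Real.sin p.1 : ℂ) * p.2 + Real.cos p.1) := by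
    funext p; exact coe_rot_smul p.1 p.2
  rw [e]
  refine Continuous.div ?_ ?_ fun p => rot_denom_ne_zero p.1 p.2
  · exact ((Complex.continuous_ofReal.comp (Real.continuous_cos.comp continuous_fst)).mul
      (UpperHalfPlane.continuous_coe.comp continuous_snd)).sub
      (Complex.continuous_ofReal.comp (Real.continuous_sin.comp continuous_fst))
  · exact ((Complex.continuous_ofReal.comp (Real.continuous_sin.comp continuous_fst)).mul
      (UpperHalfPlane.continuous_coe.comp continuous_snd)).add
      (Complex.continuous_ofReal.comp (Real.continuous_cos.comp continuous_fst))

/-- Joint continuity of `(θ, z) ↦ k(θ) z` in `ℍ`. [folklore] -/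
theorem continuous_rot_smul : Continuous fun p : ℝ × ℍ => (rot p.1 • p.2 : ℍ) := by
  have h := continuous_coe_rot_smul.upperHalfPlaneMk (fun p => (rot p.1 • p.2).im_pos)
  simpa only [UpperHalfPlane.mk_coe] using h

/-- Continuity of `θ ↦ k(θ) z`. [folklore] -/
theorem continuous_rot_smul_left (z : ℍ) : Continuous fun θ : ℝ => (rot θ • z : ℍ) := by
  have h : Continuous fun θ : ℝ => ((θ, z) : ℝ × ℍ) := by fun_prop
  have h2 := Continuous.comp continuous_rot_smul h
  exact h2

/-- **The infinitesimal rotation**: the orbit `θ ↦ k(θ) z` (in `ℂ`) has derivative `-(1 + (k(θ)z)²)`,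
i.e. the vector field generating `K` is `z ↦ -(1 + z²)`. [folklore] -/
theorem hasDerivAt_coe_rot_smul (z : ℍ) (θ : ℝ) :
    HasDerivAt (fun θ : ℝ => ((rot θ • z : ℍ) : ℂ)) (-(1 + ((rot θ • z : ℍ) : ℂ) ^ 2)) θ := by
  have e : (fun θ : ℝ => ((rot θ • z : ℍ) : ℂ)) = fun θ : ℝ =>
      ((Real.cos θ : ℂ) * z - Real.sin θ) / ((Real.sin θ : ℂ) * z + Real.cos θ) := by
    funext θ; exact coe_rot_smul θ z
  rw [e, coe_rot_smul]
  have hc : HasDerivAt (fun θ : ℝ => (Real.cos θ : ℂ)) (-(Real.sin θ : ℂ)) θ := by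
    simpa using (Real.hasDerivAt_cos θ).ofReal_comp
  have hs : HasDerivAt (fun θ : ℝ => (Real.sin θ : ℂ)) ((Real.cos θ : ℂ)) θ := by
    simpa using (Real.hasDerivAt_sin θ).ofReal_comp
  have hnum : HasDerivAt (fun θ : ℝ => (Real.cos θ : ℂ) * z - Real.sin θ)
      (-(Real.sin θ : ℂ) * z - Real.cos θ) θ := (hc.mul_const _).sub hs
  have hden : HasDerivAt (fun θ : ℝ => (Real.sin θ : ℂ) * z + Real.cos θ)
      ((Real.cos θ : ℂ) * z + -(Real.sin θ : ℂ)) θ := (hs.mul_const _).add hc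
  have hD := rot_denom_ne_zero θ z
  have h := hnum.div hden hD
  have e2 : ((fun θ : ℝ => (Real.cos θ : ℂ) * z - Real.sin θ) / fun θ : ℝ => (Real.sin θ : ℂ) * z + Real.cos θ) =
      fun θ => ((Real.cos θ : ℂ) * z - Real.sin θ) / ((Real.sin θ : ℂ) * z + Real.cos θ) := rfl
  rw [e2] at h
  refine h.congr_deriv ?_
  field_simp
  ring


/-! ## 2. The imaginary axis and geodesic polar coordinates about `i` -/

/-- The point `i e^r` of the imaginary axis (at signed hyperbolic distance `r` from `i`). [folklore] -/
def axisPt (r : ℝ) : ℍ :=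
  UpperHalfPlane.mk (Complex.I * Real.exp r) (by
    rw [Complex.mul_im, Complex.I_re, Complex.I_im, Complex.ofReal_re, Complex.ofReal_im]
    simpa using Real.exp_pos r)

/-- `i e^r` as a complex number. [folklore] -/
@[simp] theorem coe_axisPt (r : ℝ) : ((axisPt r : ℍ) : ℂ) = Complex.I * Real.exp r := rfl

/-- `Im (i e^r) = e^r`. [folklore] -/
@[simp] theorem axisPt_im (r : ℝ) : (axisPt r).im = Real.exp r := by
  rw [← UpperHalfPlane.coe_im, coe_axisPt, Complex.mul_im, Complex.I_re, Complex.I_im, Complex.ofReal_re,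
    Complex.ofReal_im]
  ring

/-- `Re (i e^r) = 0`. [folklore] -/
@[simp] theorem axisPt_re (r : ℝ) : (axisPt r).re = 0 := by
  rw [← UpperHalfPlane.coe_re, coe_axisPt]; simp

/-- `axisPt 0 = i`. [folklore] -/
theorem axisPt_zero : axisPt 0 = UpperHalfPlane.I := by
  apply UpperHalfPlane.ext; simp

/-- A point of `ℍ` with real part `0` is `i e^r` with `r = log (Im)`. [folklore] -/
theorem eq_axisPt_of_re_eq_zero {w : ℍ} (hw : w.re = 0) : w = axisPt (Real.log w.im) := by
  apply UpperHalfPlane.ext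
  rw [coe_axisPt, Complex.ofReal_exp, ← Complex.ofReal_exp, Real.exp_log w.im_pos]
  apply Complex.ext
  · simp [hw]
  · simp

/-- `k(π/2)` (i.e. `S : z ↦ -1/z`) reverses the axis: `i e^r ↦ i e^{-r}`. [folklore] -/
theorem rot_pi_div_two_smul_axisPt (r : ℝ) : rot (π / 2) • axisPt r = axisPt (-r) := by
  have h := rot_pi_div_two_smul_mk_I_mul (Real.exp_pos r)
  rw [show UpperHalfPlane.mk (Complex.I * Real.exp r) _ = axisPt r from rfl] at h
  rw [h]
  apply UpperHalfPlane.ext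
  rw [UpperHalfPlane.coe_mk, coe_axisPt, Real.exp_neg, Complex.ofReal_inv]

/-- The real part of `k(θ) w` in terms of `2θ`:
`Re k(θ)w · |w sin θ + cos θ|² = Re w · cos 2θ + ((|w|² - 1)/2) sin 2θ`. [folklore] -/
theorem re_rot_smul_mul_normSq (θ : ℝ) (w : ℍ) :
    ((rot θ • w : ℍ) : ℂ).re * Complex.normSq ((Real.sin θ : ℂ) * w + Real.cos θ) =
      w.re * Real.cos (2 * θ) + (Complex.normSq (w : ℂ) - 1) / 2 * Real.sin (2 * θ) := by
  rw [coe_rot_smul, Complex.div_re, Real.cos_two_mul, Real.sin_two_mul]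
  have hD : Complex.normSq ((Real.sin θ : ℂ) * w + Real.cos θ) ≠ 0 := by
    rw [Ne, Complex.normSq_eq_zero]; exact rot_denom_ne_zero θ w
  rw [← add_div, div_mul_cancel₀ _ hD]
  simp only [Complex.normSq_apply, Complex.mul_re, Complex.mul_im, Complex.sub_re, Complex.sub_im,
    Complex.add_re, Complex.add_im, Complex.ofReal_re, Complex.ofReal_im, UpperHalfPlane.coe_re,
    UpperHalfPlane.coe_im]
  linear_combination (-(w.re)) * Real.cos_sq_add_sin_sq θ

/-- For every `w ∈ ℍ` some rotation `k(θ)` moves `w` onto the imaginary axis. [folklore] -/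
theorem exists_rot_smul_re_eq_zero (w : ℍ) : ∃ θ : ℝ, (rot θ • w).re = 0 := by
  by_cases hA : w.re = 0
  · refine ⟨0, ?_⟩
    rw [rot_zero, one_smul]; exact hA
  · set A : ℝ := w.re
    set B : ℝ := (Complex.normSq (w : ℂ) - 1) / 2
    set ζ : ℂ := ⟨-B, A⟩ with hζ
    have hζ0 : ζ ≠ 0 := by
      intro h; apply hA
      have := congrArg Complex.im h
      simpa [hζ] using this
    refine ⟨Complex.arg ζ / 2, ?_⟩
    have hcos := Complex.cos_arg hζ0
    have hsin := Complex.sin_arg ζ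
    have hn : 0 < ‖ζ‖ := norm_pos_iff.mpr hζ0
    have key := re_rot_smul_mul_normSq (Complex.arg ζ / 2) w
    rw [show 2 * (Complex.arg ζ / 2) = Complex.arg ζ by ring, hcos, hsin] at key
    simp only [hζ] at key
    have hD : Complex.normSq ((Real.sin (Complex.arg ζ / 2) : ℂ) * w + Real.cos (Complex.arg ζ / 2)) ≠ 0 := by
      rw [Ne, Complex.normSq_eq_zero]; exact rot_denom_ne_zero _ w
    have : ((rot (Complex.arg ζ / 2) • w : ℍ) : ℂ).re *
        Complex.normSq ((Real.sin (Complex.arg ζ / 2) : ℂ) * w + Real.cos (Complex.arg ζ / 2)) = 0 := by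
      rw [key]; field_simp; ring
    rw [← UpperHalfPlane.coe_re]
    exact (mul_eq_zero.mp this).resolve_right hD

/-- **Geodesic polar coordinates about `i` cover `ℍ`** (Iwaniec (1.16): `z = k(φ) e^{-r} i`; the
stability group `K` acts transitively on every circle about `i`): every `w ∈ ℍ` is `k(θ) (i e^r)` for
some `θ, r ∈ ℝ`. [cite: Iwaniec2002, (1.16), PDF p. 15] -/
theorem exists_eq_rot_smul_axisPt (w : ℍ) : ∃ θ r : ℝ, w = rot θ • axisPt r := by
  obtain ⟨θ, hθ⟩ := exists_rot_smul_re_eq_zero w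
  refine ⟨-θ, Real.log (rot θ • w).im, ?_⟩
  rw [← eq_axisPt_of_re_eq_zero hθ, rot_smul_rot_smul, neg_add_cancel, rot_zero, one_smul]

/-! ## 3. The mean-value (rotation average) operator about `i` -/

/-- **The mean-value operator at `i`** (Iwaniec §1.8, `f_w(z) = ∫_{G_w} f(gz) dg`, here at `w = i`,
`G_i = K`, un-normalised): `(rotAvg f)(z) = ∫_0^π f(k(θ) z) dθ` (`= π f_i(z)`; `θ ∈ [0, π)` is a full
turn since `k(θ + π) = -k(θ)` acts as `k(θ)`). [cite: Iwaniec2002, §1.8 (mean-value operator) & Lemma 1.10, PDF p. 22] -/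
def rotAvg (f : ℍ → ℂ) (z : ℍ) : ℂ :=
  ∫ θ in (0 : ℝ)..π, f (rot θ • z)

/-- **Lemma 1.10 (invariance)**: the mean value is invariant under the stability group,
`(rotAvg f)(k(α) z) = (rotAvg f)(z)`. [cite: Iwaniec2002, Lemma 1.10, PDF p. 22] -/
theorem rotAvg_rot_smul (f : ℍ → ℂ) (α : ℝ) (z : ℍ) : rotAvg f (rot α • z) = rotAvg f z := by
  unfold rotAvg
  simp_rw [rot_smul_rot_smul]
  have hp : Function.Periodic (fun θ : ℝ => f (rot θ • z)) π := fun θ => by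
    simp only; rw [rot_add_pi_smul]
  rw [intervalIntegral.integral_comp_add_right (fun θ => f (rot θ • z)) α, zero_add]
  have := hp.intervalIntegral_add_eq α 0
  rw [zero_add] at this
  rw [show π + α = α + π by ring, this]

/-- **Lemma 1.10 (radiality)**: the mean value at `w = k(θ) (i e^r)` equals its value at `i e^r`.
[cite: Iwaniec2002, Lemma 1.10, PDF p. 22] -/
theorem rotAvg_eq_axisPt (f : ℍ → ℂ) {w : ℍ} {θ r : ℝ} (hw : w = rot θ • axisPt r) :
    rotAvg f w = rotAvg f (axisPt r) := by
  rw [hw, rotAvg_rot_smul]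

/-- The mean value is even along the axis: `(rotAvg f)(i e^{-r}) = (rotAvg f)(i e^r)`. [folklore] -/
theorem rotAvg_axisPt_neg (f : ℍ → ℂ) (r : ℝ) : rotAvg f (axisPt (-r)) = rotAvg f (axisPt r) := by
  rw [← rot_pi_div_two_smul_axisPt, rotAvg_rot_smul]

/-- `(rotAvg f)(i) = π f(i)` ((1.57): `f_z(z) = f(z)`). [cite: Iwaniec2002, (1.57), PDF p. 22] -/
theorem rotAvg_I (f : ℍ → ℂ) : rotAvg f UpperHalfPlane.I = π * f UpperHalfPlane.I := by
  unfold rotAvg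
  simp_rw [rot_smul_I]
  rw [intervalIntegral.integral_const, sub_zero, Complex.real_smul]

/-- Linearity of the mean value (for continuous functions). [folklore] -/
theorem rotAvg_sub_const_mul {f g : ℍ → ℂ} (hf : Continuous f) (hg : Continuous g) (c : ℂ) (z : ℍ) :
    rotAvg (fun w => f w - c * g w) z = rotAvg f z - c * rotAvg g z := by
  unfold rotAvg
  have h1 := Continuous.comp hf (continuous_rot_smul_left z)
  have h2 := Continuous.comp hg (continuous_rot_smul_left z)
  have hfi : IntervalIntegrable (fun θ : ℝ => f (rot θ • z)) volume 0 π := h1.intervalIntegrable _ _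
  have hgi : IntervalIntegrable (fun θ : ℝ => c * g (rot θ • z)) volume 0 π :=
    (continuous_const.mul h2).intervalIntegrable _ _
  rw [intervalIntegral.integral_sub hfi hgi, intervalIntegral.integral_const_mul]

/-- The mean value of a continuous function is continuous. [folklore] -/
theorem continuous_rotAvg {f : ℍ → ℂ} (hf : Continuous f) : Continuous (rotAvg f) := by
  unfold rotAvg
  have h : Continuous (Function.uncurry fun (z : ℍ) (θ : ℝ) => f (rot θ • z)) := by
    have h1 : Continuous fun p : ℍ × ℝ => ((p.2, p.1) : ℝ × ℍ) := by fun_prop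
    have h2 := Continuous.comp continuous_rot_smul h1
    have h3 := Continuous.comp hf h2
    exact h3
  exact intervalIntegral.continuous_parametric_intervalIntegral_of_continuous' h 0 π


/-! ## 4. Calculus in geodesic polar coordinates -/

section PolarCalculus

open ContinuousLinearMap InnerProductSpace Laplacian

/-! ### 4.1 Generic one-variable tools -/

/-- Second derivative along a curve: if `F` is `C²` on an open set `U ⊆ ℂ`, `c : ℝ → ℂ` maps into `U`
with `c' = u` near `t₀` and `u'(t₀) = a`, then `t ↦ DF(c t)[u t]` has derivative
`D²F(c t₀)[u t₀][u t₀] + DF(c t₀)[a]` at `t₀`. [folklore] -/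
theorem hasDerivAt_fderiv_comp_apply {F : ℂ → ℂ} {U : Set ℂ} (hU : IsOpen U)
    (hF : ContDiffOn ℝ 2 F U) {c u : ℝ → ℂ} {t₀ : ℝ} {a : ℂ} (hcU : c t₀ ∈ U)
    (hc : HasDerivAt c (u t₀) t₀) (hu : HasDerivAt u a t₀) :
    HasDerivAt (fun t => fderiv ℝ F (c t) (u t))
      (fderiv ℝ (fderiv ℝ F) (c t₀) (u t₀) (u t₀) + fderiv ℝ F (c t₀) a) t₀ := by
  have h1 : ContDiffOn ℝ 1 (fderiv ℝ F) U := hF.fderiv_of_isOpen hU (by norm_num)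
  have hA : HasFDerivAt (fderiv ℝ F) (fderiv ℝ (fderiv ℝ F) (c t₀)) (c t₀) :=
    ((h1.differentiableOn one_ne_zero).differentiableAt (hU.mem_nhds hcU)).hasFDerivAt
  have hAc : HasDerivAt (fun t => fderiv ℝ F (c t)) (fderiv ℝ (fderiv ℝ F) (c t₀) (u t₀)) t₀ :=
    hA.comp_hasDerivAt t₀ hc
  exact hAc.clm_apply hu

/-- First derivative along a curve through a `C²` (hence `C¹`) function. [folklore] -/
theorem hasDerivAt_comp_curve {F : ℂ → ℂ} {U : Set ℂ} (hU : IsOpen U)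
    (hF : ContDiffOn ℝ 2 F U) {c : ℝ → ℂ} {t₀ : ℝ} {v : ℂ} (hcU : c t₀ ∈ U)
    (hc : HasDerivAt c v t₀) :
    HasDerivAt (fun t => F (c t)) (fderiv ℝ F (c t₀) v) t₀ := by
  have hD : HasFDerivAt F (fderiv ℝ F (c t₀)) (c t₀) :=
    ((hF.differentiableOn (by norm_num)).differentiableAt (hU.mem_nhds hcU)).hasFDerivAt
  exact hD.comp_hasDerivAt t₀ hc

/-- The partial derivative `∂₁` of a function on `ℝ × ℝ` (derivative in the first variable). [folklore] -/
def dfst (g : ℝ × ℝ → ℂ) (q : ℝ × ℝ) : ℂ := fderiv ℝ g q (1, 0)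

/-- The partial derivative `∂₂` of a function on `ℝ × ℝ` (derivative in the second variable). [folklore] -/
def dsnd (g : ℝ × ℝ → ℂ) (q : ℝ × ℝ) : ℂ := fderiv ℝ g q (0, 1)

/-- `∂₁ g (r, φ)` is the derivative of the slice `r ↦ g(r, φ)`. [folklore] -/
theorem hasDerivAt_slice_fst {g : ℝ × ℝ → ℂ} {q : ℝ × ℝ} (hg : DifferentiableAt ℝ g q) :
    HasDerivAt (fun r => g (r, q.2)) (dfst g q) q.1 := by
  have h1 : HasDerivAt (fun r : ℝ => ((r, q.2) : ℝ × ℝ)) ((1, 0) : ℝ × ℝ) q.1 :=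
    (hasDerivAt_id q.1).prodMk (hasDerivAt_const q.1 q.2)
  have := hg.hasFDerivAt.comp_hasDerivAt q.1 h1
  exact this

/-- `∂₂ g (r, φ)` is the derivative of the slice `φ ↦ g(r, φ)`. [folklore] -/
theorem hasDerivAt_slice_snd {g : ℝ × ℝ → ℂ} {q : ℝ × ℝ} (hg : DifferentiableAt ℝ g q) :
    HasDerivAt (fun φ => g (q.1, φ)) (dsnd g q) q.2 := by
  have h1 : HasDerivAt (fun φ : ℝ => ((q.1, φ) : ℝ × ℝ)) ((0, 1) : ℝ × ℝ) q.2 :=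
    (hasDerivAt_const q.2 q.1).prodMk (hasDerivAt_id q.2)
  have := hg.hasFDerivAt.comp_hasDerivAt q.2 h1
  exact this

/-- `∂₂ g (r, φ₀ + ψ)` is the derivative of the shifted slice `ψ ↦ g(r, φ₀ + ψ)`. [folklore] -/
theorem hasDerivAt_slice_snd_shift {g : ℝ × ℝ → ℂ} {r φ₀ ψ : ℝ} (hg : DifferentiableAt ℝ g (r, φ₀ + ψ)) :
    HasDerivAt (fun ψ => g (r, φ₀ + ψ)) (dsnd g (r, φ₀ + ψ)) ψ := by
  have h1 : HasDerivAt (fun ψ : ℝ => ((r, φ₀ + ψ) : ℝ × ℝ)) ((0, 1) : ℝ × ℝ) ψ := by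
    refine (hasDerivAt_const ψ r).prodMk ?_
    simpa using (hasDerivAt_id ψ).const_add φ₀
  have := hg.hasFDerivAt.comp_hasDerivAt ψ h1
  exact this

/-- The partials of a `C^{n+1}` function are `C^n`. [folklore] -/
theorem contDiff_dfst {g : ℝ × ℝ → ℂ} {n : ℕ} (hg : ContDiff ℝ (n + 1) g) : ContDiff ℝ n (dfst g) := by
  unfold dfst
  have h := hg.fderiv_right (m := n) (by norm_cast)
  exact h.clm_apply contDiff_const

/-- The partials of a `C^{n+1}` function are `C^n`. [folklore] -/
theorem contDiff_dsnd {g : ℝ × ℝ → ℂ} {n : ℕ} (hg : ContDiff ℝ (n + 1) g) : ContDiff ℝ n (dsnd g) := by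
  unfold dsnd
  have h := hg.fderiv_right (m := n) (by norm_cast)
  exact h.clm_apply contDiff_const

/-! ### 4.2 The polar coordinate map and `f` in polar coordinates -/

/-- Geodesic polar coordinates about `i` as a map into `ℂ`: `(r, φ) ↦ k(φ)(i e^r)`. [cite: Iwaniec2002, (1.16), PDF p. 15] -/
def polarMap (q : ℝ × ℝ) : ℂ := ((rot q.2 • axisPt q.1 : ℍ) : ℂ)

/-- A function on `ℍ` in geodesic polar coordinates about `i`: `g(r, φ) = f(k(φ)(i e^r))`.
[cite: Iwaniec2002, (1.16), PDF p. 15] -/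
def polarFn (f : ℍ → ℂ) (q : ℝ × ℝ) : ℂ := f (rot q.2 • axisPt q.1)

/-- The polar coordinate map in coordinates: `(i e^r cos φ - sin φ)/(i e^r sin φ + cos φ)`. [folklore] -/
theorem polarMap_eq (q : ℝ × ℝ) : polarMap q =
    ((Real.cos q.2 : ℂ) * (Complex.I * Real.exp q.1) - Real.sin q.2) /
      ((Real.sin q.2 : ℂ) * (Complex.I * Real.exp q.1) + Real.cos q.2) := by
  unfold polarMap; rw [coe_rot_smul, coe_axisPt]

/-- The polar coordinate map lands in the upper half-plane. [folklore] -/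
theorem polarMap_im_pos (q : ℝ × ℝ) : 0 < (polarMap q).im := (rot q.2 • axisPt q.1).im_pos

/-- The polar coordinate map is smooth (here: `C²`, all that is used). [folklore] -/
theorem contDiff_polarMap : ContDiff ℝ 2 polarMap := by
  have e : polarMap = fun q : ℝ × ℝ =>
      ((Real.cos q.2 : ℂ) * (Complex.I * Real.exp q.1) - Real.sin q.2) *
        ((Real.sin q.2 : ℂ) * (Complex.I * Real.exp q.1) + Real.cos q.2)⁻¹ := by
    funext q; rw [polarMap_eq, div_eq_mul_inv]
  rw [e]
  have hcos : ContDiff ℝ 2 fun q : ℝ × ℝ => (Real.cos q.2 : ℂ) :=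
    Complex.ofRealCLM.contDiff.comp (Real.contDiff_cos.comp contDiff_snd)
  have hsin : ContDiff ℝ 2 fun q : ℝ × ℝ => (Real.sin q.2 : ℂ) :=
    Complex.ofRealCLM.contDiff.comp (Real.contDiff_sin.comp contDiff_snd)
  have hexp : ContDiff ℝ 2 fun q : ℝ × ℝ => Complex.I * (Real.exp q.1 : ℂ) :=
    contDiff_const.mul (Complex.ofRealCLM.contDiff.comp (Real.contDiff_exp.comp contDiff_fst))
  have h0 : ∀ q : ℝ × ℝ, (Real.sin q.2 : ℂ) * (Complex.I * Real.exp q.1) + Real.cos q.2 ≠ 0 := fun q => by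
    have := rot_denom_ne_zero q.2 (axisPt q.1)
    rwa [coe_axisPt] at this
  have hinv := ((hsin.mul hexp).add hcos).inv h0
  exact ((hcos.mul hexp).sub hsin).mul hinv

/-- `g = (f ∘ ofComplex) ∘ polarMap`. [folklore] -/
theorem polarFn_eq (f : ℍ → ℂ) : polarFn f = (f ∘ ofComplex) ∘ polarMap := by
  funext q
  simp only [polarFn, polarMap, Function.comp_apply, ofComplex_apply]

/-- `f ∈ C²(ℍ)` is `C²` in polar coordinates. [folklore] -/
theorem contDiff_polarFn {f : ℍ → ℂ} (hf : IsC2 f) : ContDiff ℝ 2 (polarFn f) := by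
  rw [polarFn_eq]
  exact hf.comp_contDiff contDiff_polarMap fun q => polarMap_im_pos q

/-- `φ ↦ g(r, φ)` is `π`-periodic. [folklore] -/
theorem polarFn_add_pi (f : ℍ → ℂ) (r φ : ℝ) : polarFn f (r, φ + π) = polarFn f (r, φ) := by
  simp only [polarFn, rot_add_pi_smul]

/-- Hence `∂₂ g` is `π`-periodic in `φ`. [folklore] -/
theorem dsnd_polarFn_add_pi {f : ℍ → ℂ} (hf : IsC2 f) (r φ : ℝ) :
    dsnd (polarFn f) (r, φ + π) = dsnd (polarFn f) (r, φ) := by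
  have hd : Differentiable ℝ (polarFn f) := (contDiff_polarFn hf).differentiable (by norm_num)
  have h1 : HasDerivAt (fun ψ => polarFn f (r, ψ)) (dsnd (polarFn f) (r, φ + π)) (φ + π) :=
    hasDerivAt_slice_snd (q := (r, φ + π)) (hd _)
  have h2 : HasDerivAt (fun ψ => polarFn f (r, ψ)) (dsnd (polarFn f) (r, φ)) φ :=
    hasDerivAt_slice_snd (q := (r, φ)) (hd _)
  -- the slice is periodic, so its derivative at `φ + π` is the derivative at `φ`
  have h3 : HasDerivAt (fun ψ => polarFn f (r, ψ + π)) (dsnd (polarFn f) (r, φ + π)) φ := by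
    have := h1.comp_add_const φ π
    simpa using this
  have e : (fun ψ => polarFn f (r, ψ + π)) = fun ψ => polarFn f (r, ψ) := funext fun ψ => polarFn_add_pi f r ψ
  rw [e] at h3
  exact h3.unique h2

/-! ### 4.3 Slices of `g` through the rotated function `F₀ = f ∘ k(φ₀)` -/

variable {f : ℍ → ℂ}

/-- The rotated function extended to `ℂ`: `F₀(p) = f(k(φ₀) p)`. [folklore] -/
def rotExt (f : ℍ → ℂ) (φ₀ : ℝ) (p : ℂ) : ℂ := f (rot φ₀ • ofComplex p)

/-- `F₀` is the `ofComplex`-extension of `f ∘ k(φ₀)`. [folklore] -/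
theorem rotExt_eq (f : ℍ → ℂ) (φ₀ : ℝ) :
    rotExt f φ₀ = (fun w : ℍ => f (rot φ₀ • w)) ∘ ofComplex := rfl

/-- `det k(θ) = 1 > 0` (in `GL₂(ℝ)`). [folklore] -/
theorem det_toGL_rot_pos (θ : ℝ) :
    0 < ((Matrix.SpecialLinearGroup.toGL (rot θ) : GL (Fin 2) ℝ)).det.val := by simp

/-- `F₀` is `C²` on the upper half-plane. [folklore] -/
theorem contDiffOn_rotExt (hf : IsC2 f) (φ₀ : ℝ) : ContDiffOn ℝ 2 (rotExt f φ₀) {p : ℂ | 0 < p.im} := by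
  rw [rotExt_eq]
  have h := IsC2.comp_smul (det_toGL_rot_pos φ₀) hf
  exact h

/-- The `r`-slice: `g(r, φ₀) = F₀(i e^r)`. [folklore] -/
theorem polarFn_eq_rotExt (f : ℍ → ℂ) (r φ₀ : ℝ) :
    polarFn f (r, φ₀) = rotExt f φ₀ (Complex.I * Real.exp r) := by
  simp only [polarFn, rotExt]
  congr 2
  rw [← coe_axisPt, ofComplex_apply]

/-- The `φ`-slice: `g(r, φ₀ + ψ) = F₀(k(ψ)(i e^r))`. [folklore] -/
theorem polarFn_shift_eq_rotExt (f : ℍ → ℂ) (r φ₀ ψ : ℝ) :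
    polarFn f (r, φ₀ + ψ) = rotExt f φ₀ ((rot ψ • axisPt r : ℍ) : ℂ) := by
  simp only [polarFn, rotExt, ofComplex_apply, rot_smul_rot_smul]

/-- The curve `r ↦ i e^r` has derivative `i e^r`. [folklore] -/
theorem hasDerivAt_I_mul_exp (r : ℝ) :
    HasDerivAt (fun r : ℝ => Complex.I * (Real.exp r : ℂ)) (Complex.I * Real.exp r) r := by
  have h : HasDerivAt (fun r : ℝ => (Real.exp r : ℂ)) ((Real.exp r : ℂ)) r := by
    simpa using (Real.hasDerivAt_exp r).ofReal_comp
  simpa using h.const_mul Complex.I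

/-- `i e^r` lies in the open upper half-plane. [folklore] -/
theorem I_mul_exp_mem (r : ℝ) : Complex.I * (Real.exp r : ℂ) ∈ {p : ℂ | 0 < p.im} := by
  show 0 < (Complex.I * (Real.exp r : ℂ)).im
  rw [Complex.mul_im, Complex.I_re, Complex.I_im, Complex.ofReal_re, Complex.ofReal_im]
  simpa using Real.exp_pos r

/-- `∂ᵣ g (r, φ₀) = DF₀(i e^r)[i e^r]`. [folklore] -/
theorem dfst_polarFn (hf : IsC2 f) (r φ₀ : ℝ) :
    dfst (polarFn f) (r, φ₀) =
      fderiv ℝ (rotExt f φ₀) (Complex.I * Real.exp r) (Complex.I * Real.exp r) := by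
  have hd : Differentiable ℝ (polarFn f) := (contDiff_polarFn hf).differentiable (by norm_num)
  have h1 : HasDerivAt (fun r => polarFn f (r, φ₀)) (dfst (polarFn f) (r, φ₀)) r :=
    hasDerivAt_slice_fst (q := (r, φ₀)) (hd _)
  have h2 : HasDerivAt (fun r => polarFn f (r, φ₀))
      (fderiv ℝ (rotExt f φ₀) (Complex.I * Real.exp r) (Complex.I * Real.exp r)) r := by
    have e : (fun r => polarFn f (r, φ₀)) = fun r => rotExt f φ₀ (Complex.I * Real.exp r) :=
      funext fun r => polarFn_eq_rotExt f r φ₀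
    rw [e]
    exact hasDerivAt_comp_curve isOpen_upperHalfPlaneSet (contDiffOn_rotExt hf φ₀) (I_mul_exp_mem r)
      (hasDerivAt_I_mul_exp r)
  exact h1.unique h2

/-- `∂ᵣ∂ᵣ g (r, φ₀) = D²F₀(c)[c][c] + DF₀(c)[c]`, `c = i e^r`. [folklore] -/
theorem dfst_dfst_polarFn (hf : IsC2 f) (r φ₀ : ℝ) :
    dfst (dfst (polarFn f)) (r, φ₀) =
      fderiv ℝ (fderiv ℝ (rotExt f φ₀)) (Complex.I * Real.exp r) (Complex.I * Real.exp r)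
          (Complex.I * Real.exp r) +
        fderiv ℝ (rotExt f φ₀) (Complex.I * Real.exp r) (Complex.I * Real.exp r) := by
  have hd1 : Differentiable ℝ (dfst (polarFn f)) :=
    (contDiff_dfst (n := 1) (contDiff_polarFn hf)).differentiable (by norm_num)
  have h1 : HasDerivAt (fun r => dfst (polarFn f) (r, φ₀)) (dfst (dfst (polarFn f)) (r, φ₀)) r :=
    hasDerivAt_slice_fst (q := (r, φ₀)) (hd1 _)
  have e : (fun r => dfst (polarFn f) (r, φ₀)) =
      fun r => fderiv ℝ (rotExt f φ₀) (Complex.I * Real.exp r) (Complex.I * Real.exp r) :=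
    funext fun r => dfst_polarFn hf r φ₀
  rw [e] at h1
  have h2 := hasDerivAt_fderiv_comp_apply isOpen_upperHalfPlaneSet (contDiffOn_rotExt hf φ₀)
    (c := fun r : ℝ => Complex.I * (Real.exp r : ℂ)) (u := fun r : ℝ => Complex.I * (Real.exp r : ℂ))
    (t₀ := r) (I_mul_exp_mem r) (hasDerivAt_I_mul_exp r) (hasDerivAt_I_mul_exp r)
  exact h1.unique h2

/-- The orbit `ψ ↦ k(ψ)(i e^r)` in `ℂ`, its value, first and second derivative at `ψ = 0`:
`c = i e^r`, `c' = -(1 + c²) = e^{2r} - 1`, `c'' = -2 c c'`. [folklore] -/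
theorem hasDerivAt_orbit (r ψ : ℝ) :
    HasDerivAt (fun ψ : ℝ => ((rot ψ • axisPt r : ℍ) : ℂ))
      (-(1 + ((rot ψ • axisPt r : ℍ) : ℂ) ^ 2)) ψ := hasDerivAt_coe_rot_smul (axisPt r) ψ

/-- The orbit at `ψ = 0` is the base point `i e^r`. [folklore] -/
theorem orbit_zero (r : ℝ) : ((rot 0 • axisPt r : ℍ) : ℂ) = Complex.I * Real.exp r := by
  rw [rot_zero, one_smul, coe_axisPt]

/-- `∂_φ g (r, φ₀ + ψ) = DF₀(k(ψ) i e^r)[-(1 + (k(ψ) i e^r)²)]`. [folklore] -/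
theorem dsnd_polarFn_shift (hf : IsC2 f) (r φ₀ ψ : ℝ) :
    dsnd (polarFn f) (r, φ₀ + ψ) =
      fderiv ℝ (rotExt f φ₀) ((rot ψ • axisPt r : ℍ) : ℂ) (-(1 + ((rot ψ • axisPt r : ℍ) : ℂ) ^ 2)) := by
  have hd : Differentiable ℝ (polarFn f) := (contDiff_polarFn hf).differentiable (by norm_num)
  have h1 : HasDerivAt (fun ψ => polarFn f (r, φ₀ + ψ)) (dsnd (polarFn f) (r, φ₀ + ψ)) ψ :=
    hasDerivAt_slice_snd_shift (hd _)
  have h2 : HasDerivAt (fun ψ => polarFn f (r, φ₀ + ψ))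
      (fderiv ℝ (rotExt f φ₀) ((rot ψ • axisPt r : ℍ) : ℂ) (-(1 + ((rot ψ • axisPt r : ℍ) : ℂ) ^ 2))) ψ := by
    have e : (fun ψ => polarFn f (r, φ₀ + ψ)) = fun ψ => rotExt f φ₀ ((rot ψ • axisPt r : ℍ) : ℂ) :=
      funext fun ψ => polarFn_shift_eq_rotExt f r φ₀ ψ
    rw [e]
    exact hasDerivAt_comp_curve isOpen_upperHalfPlaneSet (contDiffOn_rotExt hf φ₀)
      (c := fun ψ : ℝ => ((rot ψ • axisPt r : ℍ) : ℂ)) ((rot ψ • axisPt r).im_pos) (hasDerivAt_orbit r ψ)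
  exact h1.unique h2

/-- `∂_φ∂_φ g (r, φ₀) = D²F₀(c)[V][V] + DF₀(c)[-2cV]` with `c = i e^r`, `V = -(1 + c²)`. [folklore] -/
theorem dsnd_dsnd_polarFn (hf : IsC2 f) (r φ₀ : ℝ) :
    dsnd (dsnd (polarFn f)) (r, φ₀) =
      fderiv ℝ (fderiv ℝ (rotExt f φ₀)) (Complex.I * Real.exp r)
          (-(1 + (Complex.I * Real.exp r) ^ 2)) (-(1 + (Complex.I * Real.exp r) ^ 2)) +
        fderiv ℝ (rotExt f φ₀) (Complex.I * Real.exp r)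
          (-(2 * (Complex.I * Real.exp r) * (-(1 + (Complex.I * Real.exp r) ^ 2)))) := by
  have hd1 : Differentiable ℝ (dsnd (polarFn f)) :=
    (contDiff_dsnd (n := 1) (contDiff_polarFn hf)).differentiable (by norm_num)
  have h1 : HasDerivAt (fun ψ => dsnd (polarFn f) (r, φ₀ + ψ)) (dsnd (dsnd (polarFn f)) (r, φ₀ + 0)) 0 :=
    hasDerivAt_slice_snd_shift (hd1 _)
  rw [add_zero] at h1
  have e : (fun ψ => dsnd (polarFn f) (r, φ₀ + ψ)) = fun ψ =>
      fderiv ℝ (rotExt f φ₀) ((rot ψ • axisPt r : ℍ) : ℂ) (-(1 + ((rot ψ • axisPt r : ℍ) : ℂ) ^ 2)) :=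
    funext fun ψ => dsnd_polarFn_shift hf r φ₀ ψ
  rw [e] at h1
  -- derivative of the velocity `u ψ = -(1 + c(ψ)²)` at `0`
  have hu : HasDerivAt (fun ψ : ℝ => -(1 + ((rot ψ • axisPt r : ℍ) : ℂ) ^ 2))
      (-(2 * (Complex.I * Real.exp r) * (-(1 + (Complex.I * Real.exp r) ^ 2)))) 0 := by
    have h := ((hasDerivAt_orbit r 0).pow 2).const_add 1 |>.neg
    rw [orbit_zero] at h
    refine h.congr_deriv ?_
    push_cast
    ring
  have hc : HasDerivAt (fun ψ : ℝ => ((rot ψ • axisPt r : ℍ) : ℂ)) (-(1 + (Complex.I * Real.exp r) ^ 2)) 0 := by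
    have h := hasDerivAt_orbit r 0
    rwa [orbit_zero] at h
  have h2 := hasDerivAt_fderiv_comp_apply isOpen_upperHalfPlaneSet (contDiffOn_rotExt hf φ₀)
    (c := fun ψ : ℝ => ((rot ψ • axisPt r : ℍ) : ℂ))
    (u := fun ψ : ℝ => -(1 + ((rot ψ • axisPt r : ℍ) : ℂ) ^ 2)) (t₀ := 0)
    (by rw [orbit_zero]; exact I_mul_exp_mem r) (by simpa only [orbit_zero] using hc) hu
  simp only [orbit_zero] at h2
  exact h1.unique h2


/-! ### 4.4 The Laplacian in geodesic polar coordinates, divergence form -/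

/-- `Δ` of a function on `ℂ` as the trace of the second derivative: `Δ F = D²F[1,1] + D²F[i,i]`.
[folklore] -/
theorem laplacian_eq_fderiv_fderiv (F : ℂ → ℂ) (p : ℂ) :
    Δ F p = fderiv ℝ (fderiv ℝ F) p 1 1 + fderiv ℝ (fderiv ℝ F) p Complex.I Complex.I := by
  simp only [laplacian_eq_iteratedFDeriv_complexPlane, iteratedFDeriv_two_apply, Fin.isValue,
    Matrix.cons_val_zero, Matrix.cons_val_one, Matrix.cons_val_fin_one]

/-- `hypLaplacian` of `f` at `k(φ)(i e^r)` through the rotated function `F₀`: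
`(Δf)(k(φ) i e^r) = e^{2r} (D²F₀[1,1] + D²F₀[i,i])(i e^r)` (invariance of `Δ`, §1.6). [cite: Iwaniec2002, §1.6, PDF p. 16] -/
theorem hypLaplacian_rot_smul_axisPt (hf : IsC2 f) (r φ : ℝ) :
    hypLaplacian f (rot φ • axisPt r) = ((Real.exp r : ℝ) : ℂ) ^ 2 *
      (fderiv ℝ (fderiv ℝ (rotExt f φ)) (Complex.I * Real.exp r) 1 1 +
        fderiv ℝ (fderiv ℝ (rotExt f φ)) (Complex.I * Real.exp r) Complex.I Complex.I) := by
  have hg : 0 < ((Matrix.SpecialLinearGroup.toGL (rot φ) : GL (Fin 2) ℝ)).det.val := det_toGL_rot_pos φ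
  have hcd : ContDiffAt ℝ 2 (f ∘ ofComplex)
      ((((Matrix.SpecialLinearGroup.toGL (rot φ) : GL (Fin 2) ℝ)) • axisPt r : ℍ) : ℂ) :=
    hf.contDiffAt (isOpen_upperHalfPlaneSet.mem_nhds
      (((Matrix.SpecialLinearGroup.toGL (rot φ) : GL (Fin 2) ℝ)) • axisPt r).im_pos)
  have h := hypLaplacian_comp_smul hg f (axisPt r) hcd
  rw [show ((Matrix.SpecialLinearGroup.toGL (rot φ) : GL (Fin 2) ℝ)) • axisPt r = rot φ • axisPt r from rfl]
    at h
  rw [← h]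
  unfold hypLaplacian
  rw [laplacian_eq_fderiv_fderiv, axisPt_im, coe_axisPt]
  rfl

/-- The algebra of (1.20): with `y = e^r = cosh r + sinh r`, `cosh² - sinh² = 1`. [folklore] -/
theorem polarLaplacian_alg (dI d11 dII y C S : ℂ) (hS : S ≠ 0) (h1 : y = C + S) (h2 : C ^ 2 - S ^ 2 = 1) :
    C * (y * dI) + S * (y ^ 2 * dII + y * dI) +
        (4 * S)⁻¹ * ((y ^ 2 - 1) ^ 2 * d11 + (-(2 * y * (y ^ 2 - 1))) * dI) =
      S * (y ^ 2 * (d11 + dII)) := by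
  have R3 : y ^ 2 - 1 = 2 * y * S := by rw [h1]; linear_combination h2
  have e4 : (4 * S)⁻¹ * ((y ^ 2 - 1) ^ 2 * d11 + (-(2 * y * (y ^ 2 - 1))) * dI) =
      y ^ 2 * S * d11 - y ^ 2 * dI := by
    rw [R3]; field_simp; ring
  rw [e4, h1]
  ring

/-- **The hyperbolic Laplacian in geodesic polar coordinates, divergence form** (Iwaniec (1.20):
`Δ = ∂²/∂r² + (tanh r)⁻¹ ∂/∂r + (2 sinh r)⁻² ∂²/∂φ²`; multiplied by `sinh r`:
`sinh r · Δ f = ∂_r(sinh r ∂_r g) + ∂_φ((4 sinh r)⁻¹ ∂_φ g)`, here expanded as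
`cosh r ∂_r g + sinh r ∂_r² g + (4 sinh r)⁻¹ ∂_φ² g = sinh r (Δ f)(k(φ) i e^r)` for `g(r, φ) = f(k(φ) i e^r)`
and `r ≠ 0`). [cite: Iwaniec2002, (1.20), PDF p. 16] -/
theorem polarLaplacian_identity (hf : IsC2 f) {r : ℝ} (hr : r ≠ 0) (φ : ℝ) :
    (Real.cosh r : ℂ) * dfst (polarFn f) (r, φ) + (Real.sinh r : ℂ) * dfst (dfst (polarFn f)) (r, φ) +
        ((4 * Real.sinh r)⁻¹ : ℝ) * dsnd (dsnd (polarFn f)) (r, φ) =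
      (Real.sinh r : ℂ) * hypLaplacian f (rot φ • axisPt r) := by
  rw [dfst_polarFn hf, dfst_dfst_polarFn hf, dsnd_dsnd_polarFn hf, hypLaplacian_rot_smul_axisPt hf]
  set D : ℂ →L[ℝ] ℂ := fderiv ℝ (rotExt f φ) (Complex.I * Real.exp r) with hD
  set D2 : ℂ →L[ℝ] ℂ →L[ℝ] ℂ := fderiv ℝ (fderiv ℝ (rotExt f φ)) (Complex.I * Real.exp r) with hD2
  set y : ℝ := Real.exp r with hy
  set S : ℝ := Real.sinh r with hS
  set C : ℝ := Real.cosh r with hC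
  -- express every vector as a real multiple of `1` or `I`
  have ec : Complex.I * (y : ℂ) = (y : ℝ) • Complex.I := by rw [Complex.real_smul]; ring
  have eV : -(1 + ((y : ℝ) • Complex.I) ^ 2) = ((y ^ 2 - 1 : ℝ)) • (1 : ℂ) := by
    rw [Complex.real_smul, Complex.real_smul, mul_one]; push_cast; ring_nf; rw [Complex.I_sq]; ring
  have eW : -(2 * ((y : ℝ) • Complex.I) * (((y ^ 2 - 1 : ℝ)) • (1 : ℂ))) =
      ((-(2 * y * (y ^ 2 - 1)) : ℝ)) • Complex.I := by
    rw [Complex.real_smul, Complex.real_smul, Complex.real_smul, mul_one]; push_cast; ring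
  rw [ec, eV, eW]
  simp only [map_smul, smul_apply]
  simp only [Complex.real_smul]
  -- the two relations between `y = e^r`, `cosh r`, `sinh r`
  have h1 : y = C + S := by rw [hy, hC, hS, Real.cosh_add_sinh]
  have h2 : C ^ 2 - S ^ 2 = 1 := by rw [hC, hS]; exact Real.cosh_sq_sub_sinh_sq r
  have hs : S ≠ 0 := by rw [hS]; exact Real.sinh_ne_zero.mpr hr
  have key := polarLaplacian_alg (D Complex.I) (D2 1 1) (D2 Complex.I Complex.I) y C S
    (by exact_mod_cast hs) (by exact_mod_cast h1) (by exact_mod_cast h2)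
  push_cast
  linear_combination key

end PolarCalculus


/-! ## 5. The integrated radial equation (Green's identity on hyperbolic annuli about `i`) -/

section RadialODE

open ContinuousLinearMap
open scoped Interval

variable {f : ℍ → ℂ}

/-- The radial flux density `A(r, φ) = sinh r · ∂_r g(r, φ)`. [folklore] -/
def fieldR (f : ℍ → ℂ) (q : ℝ × ℝ) : ℂ := (Real.sinh q.1 : ℂ) * dfst (polarFn f) q

/-- The angular flux density `B(r, φ) = (4 sinh r)⁻¹ ∂_φ g(r, φ)`. [folklore] -/
def fieldPhi (f : ℍ → ℂ) (q : ℝ × ℝ) : ℂ := (((4 * Real.sinh q.1)⁻¹ : ℝ) : ℂ) * dsnd (polarFn f) q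

/-- `(r, φ) ↦ sinh r` (complex-valued) is `C¹`. [folklore] -/
theorem contDiff_sinhC : ContDiff ℝ 1 fun q : ℝ × ℝ => (Real.sinh q.1 : ℂ) :=
  Complex.ofRealCLM.contDiff.comp (Real.contDiff_sinh.comp contDiff_fst)

/-- The radial flux density is `C¹`. [folklore] -/
theorem contDiff_fieldR (hf : IsC2 f) : ContDiff ℝ 1 (fieldR f) :=
  contDiff_sinhC.mul (contDiff_dfst (n := 1) (contDiff_polarFn hf))

/-- `r ↦ sinh r` (complex-valued) is continuous. [folklore] -/
theorem continuous_sinhC1 : Continuous fun r : ℝ => (Real.sinh r : ℂ) :=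
  Complex.continuous_ofReal.comp Real.continuous_sinh

/-- `d/dr sinh r = cosh r` (complex-valued). [folklore] -/
theorem hasDerivAt_sinhC (r : ℝ) : HasDerivAt (fun r : ℝ => (Real.sinh r : ℂ)) (Real.cosh r : ℂ) r := by
  simpa using (Real.hasDerivAt_sinh r).ofReal_comp

/-- `∂_r A = cosh r ∂_r g + sinh r ∂_r² g`. [folklore] -/
theorem dfst_fieldR (hf : IsC2 f) (r φ : ℝ) :
    dfst (fieldR f) (r, φ) = (Real.cosh r : ℂ) * dfst (polarFn f) (r, φ) +
      (Real.sinh r : ℂ) * dfst (dfst (polarFn f)) (r, φ) := by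
  have hA : Differentiable ℝ (fieldR f) := (contDiff_fieldR hf).differentiable (by norm_num)
  have h1 : HasDerivAt (fun r => fieldR f (r, φ)) (dfst (fieldR f) (r, φ)) r :=
    hasDerivAt_slice_fst (q := (r, φ)) (hA _)
  have hd : Differentiable ℝ (dfst (polarFn f)) :=
    (contDiff_dfst (n := 1) (contDiff_polarFn hf)).differentiable (by norm_num)
  have h2 : HasDerivAt (fun r => fieldR f (r, φ)) ((Real.cosh r : ℂ) * dfst (polarFn f) (r, φ) +
      (Real.sinh r : ℂ) * dfst (dfst (polarFn f)) (r, φ)) r := by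
    have := (hasDerivAt_sinhC r).mul (hasDerivAt_slice_fst (q := (r, φ)) (hd _))
    exact this
  exact h1.unique h2

/-- The scalar factor `(4 sinh r)⁻¹` (as a function of `q = (r, φ)`) is differentiable off `r = 0`.
[folklore] -/
theorem differentiableAt_invFactor {q : ℝ × ℝ} (hq : q.1 ≠ 0) :
    DifferentiableAt ℝ (fun q : ℝ × ℝ => (((4 * Real.sinh q.1)⁻¹ : ℝ) : ℂ)) q := by
  have h1 : DifferentiableAt ℝ (fun q : ℝ × ℝ => (4 * Real.sinh q.1)⁻¹) q := by
    refine DifferentiableAt.inv ?_ ?_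
    · exact ((Real.differentiable_sinh.comp differentiable_fst).const_mul 4).differentiableAt
    · exact mul_ne_zero (by norm_num) (Real.sinh_ne_zero.mpr hq)
  exact Complex.ofRealCLM.differentiableAt.comp q h1

/-- The angular flux density is differentiable off `r = 0`. [folklore] -/
theorem differentiableAt_fieldPhi (hf : IsC2 f) {q : ℝ × ℝ} (hq : q.1 ≠ 0) :
    DifferentiableAt ℝ (fieldPhi f) q := by
  have hd : Differentiable ℝ (dsnd (polarFn f)) :=
    (contDiff_dsnd (n := 1) (contDiff_polarFn hf)).differentiable (by norm_num)
  exact (differentiableAt_invFactor hq).mul (hd q)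

/-- `∂_φ B = (4 sinh r)⁻¹ ∂_φ² g`. [folklore] -/
theorem dsnd_fieldPhi (hf : IsC2 f) {r : ℝ} (hr : r ≠ 0) (φ : ℝ) :
    dsnd (fieldPhi f) (r, φ) = (((4 * Real.sinh r)⁻¹ : ℝ) : ℂ) * dsnd (dsnd (polarFn f)) (r, φ) := by
  have h1 : HasDerivAt (fun φ => fieldPhi f (r, φ)) (dsnd (fieldPhi f) (r, φ)) φ :=
    hasDerivAt_slice_snd (q := (r, φ)) (differentiableAt_fieldPhi hf (q := (r, φ)) hr)
  have hd : Differentiable ℝ (dsnd (polarFn f)) :=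
    (contDiff_dsnd (n := 1) (contDiff_polarFn hf)).differentiable (by norm_num)
  have h2 : HasDerivAt (fun φ => fieldPhi f (r, φ))
      ((((4 * Real.sinh r)⁻¹ : ℝ) : ℂ) * dsnd (dsnd (polarFn f)) (r, φ)) φ := by
    have := (hasDerivAt_slice_snd (q := (r, φ)) (hd _)).const_mul (((4 * Real.sinh r)⁻¹ : ℝ) : ℂ)
    exact this
  exact h1.unique h2

/-- `B` is `π`-periodic in `φ`. [folklore] -/
theorem fieldPhi_add_pi (hf : IsC2 f) (r φ : ℝ) : fieldPhi f (r, φ + π) = fieldPhi f (r, φ) := by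
  simp only [fieldPhi, dsnd_polarFn_add_pi hf]

/-- The divergence of the field `(A, B)` is `sinh r · Δf = -λ sinh r · g` for an eigenfunction.
[cite: Iwaniec2002, (1.20), PDF p. 16] -/
theorem divergence_eq (hf : IsC2 f) {lam : ℂ} (heig : ∀ z, hypLaplacian f z + lam * f z = 0)
    {q : ℝ × ℝ} (hq : q.1 ≠ 0) :
    fderiv ℝ (fieldR f) q (1, 0) + fderiv ℝ (fieldPhi f) q (0, 1) =
      -lam * ((Real.sinh q.1 : ℂ) * polarFn f q) := by
  obtain ⟨r, φ⟩ := q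
  change dfst (fieldR f) (r, φ) + dsnd (fieldPhi f) (r, φ) = _
  rw [dfst_fieldR hf, dsnd_fieldPhi hf hq, polarLaplacian_identity hf hq]
  have h := heig (rot φ • axisPt r)
  simp only [polarFn]
  linear_combination (Real.sinh r : ℂ) * h

/-- The radial mean `F̃(r) = ∫_0^π g(r, φ) dφ = (rotAvg f)(i e^r)` and the flux
`Q(r) = ∫_0^π ∂_r g(r, φ) dφ`. [folklore] -/
theorem rotAvg_axisPt_eq (f : ℍ → ℂ) (r : ℝ) :
    rotAvg f (axisPt r) = ∫ φ in (0 : ℝ)..π, polarFn f (r, φ) := rfl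

/-- **Green's identity on the annulus `ε ≤ ρ(z, i) ≤ R`** (the divergence theorem in geodesic polar
coordinates, the `φ`-boundary terms cancelling by periodicity): for a `C²` eigenfunction,
`-λ ∫_ε^R sinh r F̃(r) dr = sinh R · Q(R) - sinh ε · Q(ε)` with `F̃(r) = (rotAvg f)(i e^r)`,
`Q(r) = ∫_0^π ∂_r g(r, φ) dφ`. [folklore] -/
theorem radial_identity_annulus (hf : IsC2 f) {lam : ℂ} (heig : ∀ z, hypLaplacian f z + lam * f z = 0)
    {ε R : ℝ} (hε : 0 < ε) (hεR : ε ≤ R) :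
    -lam * ∫ r in ε..R, (Real.sinh r : ℂ) * rotAvg f (axisPt r) =
      (Real.sinh R : ℂ) * (∫ φ in (0 : ℝ)..π, dfst (polarFn f) (R, φ)) -
        (Real.sinh ε : ℂ) * ∫ φ in (0 : ℝ)..π, dfst (polarFn f) (ε, φ) := by
  have hA : Differentiable ℝ (fieldR f) := (contDiff_fieldR hf).differentiable (by norm_num)
  -- the divergence theorem on the box [ε, R] × [0, π]
  have hbox : ∀ q ∈ ([[ε, R]] ×ˢ [[(0 : ℝ), π]] : Set (ℝ × ℝ)), q.1 ≠ 0 := by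
    intro q hq
    rw [Set.uIcc_of_le hεR] at hq
    exact ne_of_gt (lt_of_lt_of_le hε hq.1.1)
  have Hcf : ContinuousOn (fieldR f) ([[ε, R]] ×ˢ [[(0 : ℝ), π]]) := hA.continuous.continuousOn
  have Hcg : ContinuousOn (fieldPhi f) ([[ε, R]] ×ˢ [[(0 : ℝ), π]]) := fun q hq =>
    (differentiableAt_fieldPhi hf (hbox q hq)).continuousAt.continuousWithinAt
  have Hdf : ∀ q ∈ Ioo (min ε R) (max ε R) ×ˢ Ioo (min 0 π) (max 0 π),
      HasFDerivAt (fieldR f) (fderiv ℝ (fieldR f) q) q := fun q _ => (hA q).hasFDerivAt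
  have Hdg : ∀ q ∈ Ioo (min ε R) (max ε R) ×ˢ Ioo (min 0 π) (max 0 π),
      HasFDerivAt (fieldPhi f) (fderiv ℝ (fieldPhi f) q) q := by
    intro q hq
    rw [min_eq_left hεR, max_eq_right hεR] at hq
    exact (differentiableAt_fieldPhi hf (ne_of_gt (lt_trans hε hq.1.1))).hasFDerivAt
  have hcont : Continuous fun q : ℝ × ℝ => -lam * ((Real.sinh q.1 : ℂ) * polarFn f q) :=
    continuous_const.mul (contDiff_sinhC.continuous.mul (contDiff_polarFn hf).continuous)
  have Hi : IntegrableOn (fun q => fderiv ℝ (fieldR f) q (1, 0) + fderiv ℝ (fieldPhi f) q (0, 1))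
      ([[ε, R]] ×ˢ [[(0 : ℝ), π]]) := by
    have hK : IsCompact ([[ε, R]] ×ˢ [[(0 : ℝ), π]] : Set (ℝ × ℝ)) := isCompact_uIcc.prod isCompact_uIcc
    refine (hcont.continuousOn.integrableOn_compact hK).congr_fun (fun q hq => ?_)
      (measurableSet_uIcc.prod measurableSet_uIcc)
    exact (divergence_eq hf heig (hbox q hq)).symm
  have hDT := integral2_divergence_prod_of_hasFDerivAt (fieldR f) (fieldPhi f)
    (fun q => fderiv ℝ (fieldR f) q) (fun q => fderiv ℝ (fieldPhi f) q) ε 0 R π Hcf Hcg Hdf Hdg Hi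
  -- the φ-boundary terms cancel
  have hper : (∫ r in ε..R, fieldPhi f (r, π)) = ∫ r in ε..R, fieldPhi f (r, 0) := by
    congr 1 with r
    have := fieldPhi_add_pi hf r 0
    rwa [zero_add] at this
  rw [hper, sub_self, zero_add] at hDT
  -- the divergence integrand is `-λ sinh r · g`
  have hlhs : (∫ r in ε..R, ∫ φ in (0 : ℝ)..π,
      fderiv ℝ (fieldR f) (r, φ) (1, 0) + fderiv ℝ (fieldPhi f) (r, φ) (0, 1)) =
      -lam * ∫ r in ε..R, (Real.sinh r : ℂ) * rotAvg f (axisPt r) := by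
    rw [← intervalIntegral.integral_const_mul]
    refine intervalIntegral.integral_congr fun r hr => ?_
    have hr0 : r ≠ 0 := by
      rw [Set.uIcc_of_le hεR] at hr
      exact ne_of_gt (lt_of_lt_of_le hε hr.1)
    rw [rotAvg_axisPt_eq, ← intervalIntegral.integral_const_mul, ← intervalIntegral.integral_const_mul]
    refine intervalIntegral.integral_congr fun φ _ => ?_
    rw [divergence_eq hf heig (q := (r, φ)) hr0]
  rw [hlhs] at hDT
  rw [hDT]
  simp only [fieldR]
  rw [intervalIntegral.integral_const_mul, intervalIntegral.integral_const_mul]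

end RadialODE


/-! ## 6. The radial mean of an eigenfunction vanishing at `i` vanishes (Lemma 1.12 / Cor. 1.13) -/

section Uniqueness

open scoped Interval

variable {f : ℍ → ℂ}

/-- The radial flux `Q(r) = ∫_0^π ∂_r g(r, φ) dφ`. [folklore] -/
def radFlux (f : ℍ → ℂ) (r : ℝ) : ℂ := ∫ φ in (0 : ℝ)..π, dfst (polarFn f) (r, φ)

/-- The radial flux `Q` is continuous. [folklore] -/
theorem continuous_radFlux (hf : IsC2 f) : Continuous (radFlux f) := by
  unfold radFlux
  have hc : Continuous (dfst (polarFn f)) := (contDiff_dfst (n := 1) (contDiff_polarFn hf)).continuous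
  have h : Continuous (Function.uncurry fun (r : ℝ) (φ : ℝ) => dfst (polarFn f) (r, φ)) :=
    hc.comp (continuous_fst.prodMk continuous_snd)
  exact intervalIntegral.continuous_parametric_intervalIntegral_of_continuous' h 0 π

/-- The radial mean `r ↦ (rotAvg f)(i e^r)` is continuous. [folklore] -/
theorem continuous_rotAvg_axisPt (hf : IsC2 f) : Continuous fun r : ℝ => rotAvg f (axisPt r) := by
  simp_rw [rotAvg_axisPt_eq]
  have hc : Continuous (polarFn f) := (contDiff_polarFn hf).continuous
  have h : Continuous (Function.uncurry fun (r : ℝ) (φ : ℝ) => polarFn f (r, φ)) :=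
    hc.comp (continuous_fst.prodMk continuous_snd)
  exact intervalIntegral.continuous_parametric_intervalIntegral_of_continuous' h 0 π

/-- `F̃'(r) = Q(r)`: differentiation of the radial mean under the integral sign (the integrand is
`C¹` with derivative bounded on compacta). [folklore] -/
theorem hasDerivAt_rotAvg_axisPt (hf : IsC2 f) (r₀ : ℝ) :
    HasDerivAt (fun r : ℝ => rotAvg f (axisPt r)) (radFlux f r₀) r₀ := by
  simp_rw [rotAvg_axisPt_eq]
  unfold radFlux
  have hc : Continuous (polarFn f) := (contDiff_polarFn hf).continuous
  have hd : Differentiable ℝ (polarFn f) := (contDiff_polarFn hf).differentiable (by norm_num)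
  have hc1 : Continuous (dfst (polarFn f)) := (contDiff_dfst (n := 1) (contDiff_polarFn hf)).continuous
  -- a uniform bound for `∂_r g` on `[r₀ - 1, r₀ + 1] × [0, π]`
  have hK : IsCompact (Icc (r₀ - 1) (r₀ + 1) ×ˢ Icc (0 : ℝ) π) := isCompact_Icc.prod isCompact_Icc
  obtain ⟨M, hM⟩ := hK.exists_bound_of_continuousOn hc1.continuousOn
  have key := intervalIntegral.hasDerivAt_integral_of_dominated_loc_of_deriv_le
    (μ := volume) (a := (0 : ℝ)) (b := π) (𝕜 := ℝ)
    (F := fun (r : ℝ) (φ : ℝ) => polarFn f (r, φ)) (F' := fun (r : ℝ) (φ : ℝ) => dfst (polarFn f) (r, φ))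
    (x₀ := r₀) (s := Metric.ball r₀ 1) (bound := fun _ => M) (Metric.ball_mem_nhds r₀ one_pos)
    (Eventually.of_forall fun r =>
      ((hc.comp (continuous_const.prodMk continuous_id)).aestronglyMeasurable))
    ((hc.comp (continuous_const.prodMk continuous_id)).intervalIntegrable _ _)
    ((hc1.comp (continuous_const.prodMk continuous_id)).aestronglyMeasurable)
    (Eventually.of_forall fun φ hφ r hr => hM (r, φ) ⟨?_, ?_⟩)
    intervalIntegrable_const
    (Eventually.of_forall fun φ _ r _ => hasDerivAt_slice_fst (q := (r, φ)) (hd _))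
  · exact key.2
  · have : dist r r₀ < 1 := hr
    rw [Real.dist_eq] at this
    constructor <;> linarith [abs_lt.mp this |>.1, abs_lt.mp this |>.2]
  · rw [Set.uIoc_of_le Real.pi_pos.le] at hφ
    exact ⟨hφ.1.le, hφ.2⟩

/-- **The integrated radial equation**: for a `C²` eigenfunction, `(Δ + λ) f = 0`, and every `R > 0`,
`sinh R · F̃'(R) = -λ ∫_0^R sinh r F̃(r) dr` — the divergence form `(sinh r F̃')' = -λ sinh r F̃` of the
radial equation `F̃'' + coth r F̃' + λ F̃ = 0` ((1.20) on radial functions), integrated from `0`.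
[cite: Iwaniec2002, (1.20) & Lemma 1.12, PDF pp. 16, 23] -/
theorem radial_identity (hf : IsC2 f) {lam : ℂ} (heig : ∀ z, hypLaplacian f z + lam * f z = 0)
    {R : ℝ} (hR : 0 < R) :
    (Real.sinh R : ℂ) * radFlux f R = -lam * ∫ r in (0 : ℝ)..R, (Real.sinh r : ℂ) * rotAvg f (axisPt r) := by
  -- Φ(ε) := sinh ε Q(ε) + λ ∫_0^ε sinh r F̃(r) dr is constant on (0, ∞) and → Φ(0) = 0
  set G : ℝ → ℂ := fun r => (Real.sinh r : ℂ) * rotAvg f (axisPt r) with hG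
  have hGc : Continuous G := continuous_sinhC1.mul (continuous_rotAvg_axisPt hf)
  set Φ : ℝ → ℂ := fun ε => (Real.sinh ε : ℂ) * radFlux f ε + lam * ∫ r in (0 : ℝ)..ε, G r with hΦ
  have hΦc : Continuous Φ := by
    refine (continuous_sinhC1.mul (continuous_radFlux hf)).add (continuous_const.mul ?_)
    exact intervalIntegral.continuous_primitive (fun a b => hGc.intervalIntegrable a b) 0
  have hΦ0 : Φ 0 = 0 := by simp [hΦ]
  have hconst : ∀ ε ∈ Set.Ioo 0 R, Φ ε = Φ R := by
    intro ε hε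
    have h := radial_identity_annulus hf heig hε.1 hε.2.le
    have hsplit : (∫ r in ε..R, G r) = (∫ r in (0 : ℝ)..R, G r) - ∫ r in (0 : ℝ)..ε, G r :=
      (intervalIntegral.integral_interval_sub_left (hGc.intervalIntegrable 0 R)
        (hGc.intervalIntegrable 0 ε)).symm
    simp only [hΦ, radFlux]
    rw [hsplit] at h
    linear_combination h
  -- limit along ε → 0⁺
  have h1 : Tendsto Φ (𝓝[>] 0) (𝓝 (Φ 0)) := hΦc.continuousAt.tendsto.mono_left nhdsWithin_le_nhds
  have h2 : Tendsto Φ (𝓝[>] 0) (𝓝 (Φ R)) := by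
    refine tendsto_const_nhds.congr' ?_
    filter_upwards [Ioo_mem_nhdsGT hR] with ε hε
    exact (hconst ε hε).symm
  have hΦR : Φ R = 0 := by rw [← hΦ0]; exact tendsto_nhds_unique h2 h1
  simp only [hΦ] at hΦR
  linear_combination hΦR

/-- The flux is controlled by the radial mean: `‖Q(t)‖ ≤ ‖λ‖ ∫_0^t ‖F̃‖` for `t > 0`
(`sinh r ≤ sinh t` on `[0, t]`). [folklore] -/
theorem norm_radFlux_le (hf : IsC2 f) {lam : ℂ} (heig : ∀ z, hypLaplacian f z + lam * f z = 0)
    {t : ℝ} (ht : 0 < t) :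
    ‖radFlux f t‖ ≤ ‖lam‖ * ∫ r in (0 : ℝ)..t, ‖rotAvg f (axisPt r)‖ := by
  have hst : 0 < Real.sinh t := Real.sinh_pos_iff.mpr ht
  have h := radial_identity hf heig ht
  have hGc : Continuous fun r : ℝ => ‖rotAvg f (axisPt r)‖ := (continuous_rotAvg_axisPt hf).norm
  have hbound : ‖∫ r in (0 : ℝ)..t, (Real.sinh r : ℂ) * rotAvg f (axisPt r)‖ ≤
      ∫ r in (0 : ℝ)..t, Real.sinh t * ‖rotAvg f (axisPt r)‖ := by
    refine intervalIntegral.norm_integral_le_of_norm_le ht.le (Eventually.of_forall fun r hr => ?_)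
      ((continuous_const.mul hGc).intervalIntegrable _ _)
    rw [norm_mul, Complex.norm_real, Real.norm_eq_abs, abs_of_nonneg (Real.sinh_nonneg_iff.mpr hr.1.le)]
    exact mul_le_mul_of_nonneg_right (Real.sinh_le_sinh.mpr hr.2) (norm_nonneg _)
  rw [intervalIntegral.integral_const_mul] at hbound
  have e : ‖radFlux f t‖ = ‖lam‖ * ‖∫ r in (0 : ℝ)..t, (Real.sinh r : ℂ) * rotAvg f (axisPt r)‖ / Real.sinh t := by
    have := congrArg norm h
    rw [norm_mul, norm_mul, norm_neg, Complex.norm_real, Real.norm_eq_abs, abs_of_pos hst] at this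
    field_simp
    linear_combination this
  rw [e, div_le_iff₀ hst]
  calc ‖lam‖ * ‖∫ r in (0 : ℝ)..t, (Real.sinh r : ℂ) * rotAvg f (axisPt r)‖
      ≤ ‖lam‖ * (Real.sinh t * ∫ r in (0 : ℝ)..t, ‖rotAvg f (axisPt r)‖) :=
        mul_le_mul_of_nonneg_left hbound (norm_nonneg _)
    _ = ‖lam‖ * (∫ r in (0 : ℝ)..t, ‖rotAvg f (axisPt r)‖) * Real.sinh t := by ring

/-- **Lemma 1.12 / Corollary 1.13 (uniqueness of radial eigenfunctions), radial-mean form**: if `f`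
is a `C²` eigenfunction of `Δ` on `ℍ` with `f(i) = 0`, then its rotation mean about `i` vanishes on
the whole axis: `(rotAvg f)(i e^r) = 0` for all `r`. (Gronwall's inequality for
`H(R) = ∫_0^R ‖F̃‖`: `H' = ‖F̃‖ ≤ ∫_0^R ‖Q‖ ≤ R₀‖λ‖ H`, `H(0) = 0`; evenness in `r`.)
[cite: Iwaniec2002, Lemma 1.12 & Cor. 1.13, PDF p. 23] -/
theorem rotAvg_axisPt_eq_zero (hf : IsC2 f) {lam : ℂ} (heig : ∀ z, hypLaplacian f z + lam * f z = 0)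
    (h0 : f UpperHalfPlane.I = 0) (r : ℝ) : rotAvg f (axisPt r) = 0 := by
  -- reduce to r ≥ 0 by evenness
  wlog hr : 0 ≤ r generalizing r
  · have h := this (-r) (by linarith)
    rwa [rotAvg_axisPt_neg] at h
  set Ft : ℝ → ℂ := fun r => rotAvg f (axisPt r) with hFt
  have hFc : Continuous Ft := continuous_rotAvg_axisPt hf
  have hF0 : Ft 0 = 0 := by simp only [hFt, axisPt_zero, rotAvg_I, h0, mul_zero]
  have hQc : Continuous (radFlux f) := continuous_radFlux hf
  -- F̃(x) = ∫_0^x Q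
  have hFTC : ∀ x, Ft x = ∫ t in (0 : ℝ)..x, radFlux f t := by
    intro x
    have e := intervalIntegral.integral_eq_sub_of_hasDerivAt (fun t _ => hasDerivAt_rotAvg_axisPt hf t)
      (hQc.intervalIntegrable 0 x)
    have hF0' : rotAvg f (axisPt 0) = 0 := hF0
    rw [hF0', sub_zero] at e
    exact e.symm
  -- Gronwall for H(R) = ∫_0^R ‖F̃‖ on [0, R₀], R₀ = r + 1
  set R₀ : ℝ := r + 1 with hR₀
  set H : ℝ → ℝ := fun R => ∫ t in (0 : ℝ)..R, ‖Ft t‖ with hH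
  have hHd : ∀ x, HasDerivAt H ‖Ft x‖ x := fun x =>
    intervalIntegral.integral_hasDerivAt_right (hFc.norm.intervalIntegrable _ _)
      hFc.norm.aestronglyMeasurable.stronglyMeasurableAtFilter hFc.norm.continuousAt
  have hHmono : ∀ {a b : ℝ}, 0 ≤ a → a ≤ b → H a ≤ H b := by
    intro a b ha hab
    simp only [hH]
    rw [← intervalIntegral.integral_add_adjacent_intervals (hFc.norm.intervalIntegrable 0 a)
      (hFc.norm.intervalIntegrable a b)]
    have : 0 ≤ ∫ t in a..b, ‖Ft t‖ := intervalIntegral.integral_nonneg hab fun t _ => norm_nonneg _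
    linarith
  have hHnn : ∀ {a : ℝ}, 0 ≤ a → 0 ≤ H a := fun {a} ha =>
    intervalIntegral.integral_nonneg ha fun t _ => norm_nonneg _
  have hbound : ∀ x ∈ Set.Ico 0 R₀, ‖(‖Ft x‖ : ℝ)‖ ≤ ‖lam‖ * R₀ * ‖H x‖ := by
    intro x hx
    rw [Real.norm_eq_abs, abs_of_nonneg (norm_nonneg _), Real.norm_eq_abs, abs_of_nonneg (hHnn hx.1),
      hFTC x]
    have hQle : ∀ t ∈ Set.Ioc 0 x, ‖radFlux f t‖ ≤ ‖lam‖ * H x := by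
      intro t ht
      refine (norm_radFlux_le hf heig ht.1).trans ?_
      exact mul_le_mul_of_nonneg_left (hHmono ht.1.le ht.2) (norm_nonneg _)
    calc ‖∫ t in (0 : ℝ)..x, radFlux f t‖
        ≤ ∫ t in (0 : ℝ)..x, ‖lam‖ * H x :=
          intervalIntegral.norm_integral_le_of_norm_le hx.1 (Eventually.of_forall hQle)
            intervalIntegrable_const
      _ = ‖lam‖ * H x * x := by rw [intervalIntegral.integral_const, smul_eq_mul]; ring
      _ ≤ ‖lam‖ * H x * R₀ := by
          refine mul_le_mul_of_nonneg_left hx.2.le (mul_nonneg (norm_nonneg _) (hHnn hx.1))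
      _ = ‖lam‖ * R₀ * H x := by ring
  have hH0 : H 0 = 0 := by simp [hH]
  have hzero := eq_zero_of_abs_deriv_le_mul_abs_self_of_eq_zero_right (f := H) (f' := fun x => ‖Ft x‖)
    (K := ‖lam‖ * R₀) (a := 0) (b := R₀) (HasDerivAt.continuousOn fun x _ => hHd x)
    (fun x _ => (hHd x).hasDerivWithinAt) hH0 hbound
  -- conclude at r ∈ [0, R₀)
  have hrR : r ∈ Set.Ico 0 R₀ := ⟨hr, by rw [hR₀]; linarith⟩
  have h1 := hbound r hrR
  rw [hzero r (Set.Ico_subset_Icc_self hrR), norm_zero, mul_zero, Real.norm_eq_abs,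
    abs_of_nonneg (norm_nonneg _)] at h1
  exact norm_le_zero_iff.mp h1

/-- Hence the rotation mean of such an `f` vanishes identically on `ℍ` (geodesic polar
coordinates cover `ℍ` and the mean is rotation invariant). [cite: Iwaniec2002, Cor. 1.13, PDF p. 23] -/
theorem rotAvg_eq_zero (hf : IsC2 f) {lam : ℂ} (heig : ∀ z, hypLaplacian f z + lam * f z = 0)
    (h0 : f UpperHalfPlane.I = 0) (w : ℍ) : rotAvg f w = 0 := by
  obtain ⟨θ, r, hw⟩ := exists_eq_rot_smul_axisPt w
  rw [rotAvg_eq_axisPt f hw]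
  exact rotAvg_axisPt_eq_zero hf heig h0 r

end Uniqueness

open scoped Interval

/-! ## 7. Theorem 1.14 / 1.16: eigenfunctions of `Δ` are eigenfunctions of every `L_k`, eigenvalue `h(t)` -/

section Theorem116

variable {k : ℝ → ℝ} {f : ℍ → ℂ}

/-- A `C²` function on `ℍ` is continuous. [folklore] -/
theorem IsC2.continuous (hf : IsC2 f) : Continuous f := by
  have hc : ContinuousOn (f ∘ ofComplex) {z : ℂ | 0 < z.im} := hf.continuousOn
  have h2 : Continuous ((f ∘ ofComplex) ∘ UpperHalfPlane.coe) :=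
    hc.comp_continuous UpperHalfPlane.continuous_coe fun w => w.im_pos
  have e : (f ∘ ofComplex) ∘ UpperHalfPlane.coe = f := by
    funext w; simp [ofComplex_apply]
  rwa [e] at h2

/-- Rotations preserve the distance to `i`. [folklore] -/
theorem dist_rot_smul_I (θ : ℝ) (w : ℍ) : dist (rot θ • w) UpperHalfPlane.I = dist w UpperHalfPlane.I := by
  conv_lhs => rw [← rot_smul_I θ]
  exact dist_smul (rot θ) w UpperHalfPlane.I

/-- **Lemma 1.11** (an invariant integral operator is not altered by the mean-value operator):
`L_k(rotAvg f)(i) = π (L_k f)(i)` (`rotAvg = π ·` the normalised mean `f_i`). Fubini over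
`[0, π] × ℍ`, invariance `L_k(f ∘ k(θ)) = (L_k f) ∘ k(θ)` and `k(θ) i = i`.
[cite: Iwaniec2002, Lemma 1.11, PDF pp. 22–23] -/
theorem invariantOperator_rotAvg_I (hk : IsTestKernel k) (hf : Continuous f) :
    invariantOperator k (rotAvg f) UpperHalfPlane.I = π * invariantOperator k f UpperHalfPlane.I := by
  obtain ⟨hkm, ⟨B, hB⟩, ⟨M, hM0, hM⟩⟩ := id hk
  set R : ℝ := 2 * Real.arsinh (Real.sqrt M) with hR
  set F : ℍ → ℝ → ℂ := fun w θ => (k (pointPairInv UpperHalfPlane.I w) : ℂ) * f (rot θ • w) with hF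
  -- integrability on `ℍ × (0, π]`
  set ν : Measure ℝ := volume.restrict (Set.Ioc 0 π) with hν
  haveI : IsFiniteMeasure ν := by
    rw [hν]; exact ⟨by simp [Real.volume_Ioc]⟩
  have hcontf : Continuous fun p : ℍ × ℝ => f (rot p.2 • p.1) := by
    have h1 : Continuous fun p : ℍ × ℝ => ((p.2, p.1) : ℝ × ℍ) := by fun_prop
    have h2 := Continuous.comp continuous_rot_smul h1
    exact Continuous.comp hf h2
  have hmeas : AEStronglyMeasurable (Function.uncurry F) ((volume : Measure ℍ).prod ν) := by
    have hm1 : Measurable fun p : ℍ × ℝ => (k (pointPairInv UpperHalfPlane.I p.1) : ℂ) :=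
      Complex.measurable_ofReal.comp ((measurable_kernel hkm UpperHalfPlane.I).comp measurable_fst)
    exact (hm1.aestronglyMeasurable.mul hcontf.aestronglyMeasurable)
  -- a bound for `f` on the ball about `i` carrying the kernel
  obtain ⟨C, hC⟩ := (isCompact_closedBall UpperHalfPlane.I R).exists_bound_of_continuousOn hf.continuousOn
  have hR0 : 0 ≤ R := by
    rw [hR]; exact mul_nonneg (by norm_num) (Real.arsinh_nonneg_iff.mpr (Real.sqrt_nonneg M))
  have hC0 : 0 ≤ C := (norm_nonneg _).trans (hC UpperHalfPlane.I (Metric.mem_closedBall_self hR0))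
  have hB0 : 0 ≤ B := (abs_nonneg _).trans (hB 0)
  have hbound : ∀ p : ℍ × ℝ, ‖Function.uncurry F p‖ ≤
      (Metric.closedBall UpperHalfPlane.I R ×ˢ (Set.univ : Set ℝ)).indicator (fun _ => B * C) p := by
    rintro ⟨w, θ⟩
    simp only [Function.uncurry_apply_pair, hF]
    by_cases hw : w ∈ Metric.closedBall UpperHalfPlane.I R
    · rw [Set.indicator_of_mem (Set.mk_mem_prod hw (Set.mem_univ θ)), norm_mul, Complex.norm_real,
        Real.norm_eq_abs]
      refine mul_le_mul (hB _) (hC _ ?_) (norm_nonneg _) hB0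
      rw [Metric.mem_closedBall, dist_rot_smul_I]; exact hw
    · rw [Set.indicator_of_notMem (fun h => hw h.1)]
      rw [Metric.mem_closedBall, not_le, dist_comm] at hw
      rw [kernel_eq_zero_of_dist hM hw]
      simp
  have hint : Integrable (Function.uncurry F) ((volume : Measure ℍ).prod ν) := by
    refine Integrable.mono' ?_ hmeas (Eventually.of_forall hbound)
    refine (integrableOn_const (C := B * C) ?_).integrable_indicator
      (Metric.isClosed_closedBall.measurableSet.prod MeasurableSet.univ)
    rw [Measure.prod_prod]
    exact ENNReal.mul_ne_top (isCompact_closedBall _ _).measure_lt_top.ne (measure_ne_top ν _)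
  -- Fubini
  have hswap := MeasureTheory.integral_integral_swap hint
  -- left side: `L_k (rotAvg f)(i)`
  have hL : invariantOperator k (rotAvg f) UpperHalfPlane.I = ∫ w, ∫ θ, F w θ ∂ν := by
    unfold invariantOperator rotAvg
    congr 1 with w
    rw [intervalIntegral.integral_of_le Real.pi_pos.le, ← integral_const_mul]
  -- right side: for each θ the inner integral is `L_k f (k(θ) i) = L_k f (i)`
  have hRt : ∀ θ, ∫ w, F w θ = invariantOperator k f UpperHalfPlane.I := by
    intro θ
    have := invariantOperator_comp_smul k f (rot θ) UpperHalfPlane.I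
    rw [rot_smul_I] at this
    rw [← this]
    rfl
  rw [hL, hswap]
  simp_rw [hRt]
  rw [integral_const, Complex.real_smul]
  congr 1
  rw [hν, Measure.real, Measure.restrict_apply_univ, Real.volume_Ioc, sub_zero,
    ENNReal.toReal_ofReal Real.pi_pos.le]

/-- `C²` is closed under `f ↦ f - c·g`. [folklore] -/
theorem IsC2.sub_const_mul (hf : IsC2 f) {g : ℍ → ℂ} (hg : IsC2 g) (c : ℂ) :
    IsC2 (fun w => f w - c * g w) := by
  have e : ((fun w => f w - c * g w) ∘ ofComplex : ℂ → ℂ) = (f ∘ ofComplex) - c • (g ∘ ofComplex) := by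
    funext p; simp [smul_eq_mul]
  unfold IsC2
  rw [e]
  exact hf.sub (hg.const_smul c)

/-- `hypLaplacian` is linear on `C²` functions: `Δ(f - c g) = Δ f - c Δ g`. [folklore] -/
theorem hypLaplacian_sub_const_mul (hf : IsC2 f) {g : ℍ → ℂ} (hg : IsC2 g) (c : ℂ) (z : ℍ) :
    hypLaplacian (fun w => f w - c * g w) z = hypLaplacian f z - c * hypLaplacian g z := by
  unfold hypLaplacian
  have e : ((fun w => f w - c * g w) ∘ ofComplex : ℂ → ℂ) = (f ∘ ofComplex) - c • (g ∘ ofComplex) := by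
    funext p; simp [smul_eq_mul]
  have h1 : ContDiffAt ℝ 2 (f ∘ ofComplex) (z : ℂ) := hf.contDiffAt (isOpen_upperHalfPlaneSet.mem_nhds z.im_pos)
  have h2 : ContDiffAt ℝ 2 (g ∘ ofComplex) (z : ℂ) := hg.contDiffAt (isOpen_upperHalfPlaneSet.mem_nhds z.im_pos)
  have h2' : ContDiffAt ℝ 2 (c • (g ∘ ofComplex)) (z : ℂ) := h2.const_smul c
  rw [e, ContDiffAt.laplacian_sub h1 h2', InnerProductSpace.laplacian_smul c h2]
  simp only [smul_eq_mul]
  ring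

/-- `(Im ·)^s` is `C²` on `ℍ`. [folklore] -/
theorem isC2_im_cpow (s : ℂ) : IsC2 (fun w : ℍ => ((w.im : ℝ) : ℂ) ^ s) := by
  intro p hp
  have h := contDiffAt_im_cpow_extend s ⟨p, hp⟩
  exact h.contDiffWithinAt

/-- **Theorems 1.14 & 1.16 at the point `i`.** [cite: Iwaniec2002, Thms 1.14 & 1.16, PDF pp. 23–24] -/
theorem invariantOperator_eigenfunction_I (hk : IsTestKernel k) (hf : IsC2 f) (t : ℂ)
    (heig : ∀ z, hypLaplacian f z + (1 / 4 + t ^ 2) * f z = 0) :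
    invariantOperator k f UpperHalfPlane.I = selbergTransform k t * f UpperHalfPlane.I := by
  set s : ℂ := 1 / 2 + Complex.I * t with hs
  set ys : ℍ → ℂ := fun w => ((w.im : ℝ) : ℂ) ^ s with hys
  set c : ℂ := f UpperHalfPlane.I with hc
  have hysC2 : IsC2 ys := isC2_im_cpow s
  have hys_eig : ∀ z, hypLaplacian ys z + (1 / 4 + t ^ 2) * ys z = 0 := by
    intro z
    have h := hypLaplacian_im_cpow s z
    have e : s * (1 - s) = 1 / 4 + t ^ 2 := by
      rw [hs]; ring_nf; rw [Complex.I_sq]; ring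
    rw [← e]
    exact h
  have hysI : ys UpperHalfPlane.I = 1 := by simp [hys, UpperHalfPlane.I_im]
  -- g = f - c y^s is a C² eigenfunction vanishing at i
  set g : ℍ → ℂ := fun w => f w - c * ys w with hg
  have hgC2 : IsC2 g := hf.sub_const_mul hysC2 c
  have hg_eig : ∀ z, hypLaplacian g z + (1 / 4 + t ^ 2) * g z = 0 := by
    intro z
    rw [hg, hypLaplacian_sub_const_mul hf hysC2 c z]
    have h1 := heig z
    have h2 := hys_eig z
    simp only
    linear_combination h1 - c * h2
  have hg0 : g UpperHalfPlane.I = 0 := by simp [hg, hysI, hc]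
  have hgavg : ∀ w, rotAvg g w = 0 := rotAvg_eq_zero hgC2 hg_eig hg0
  -- hence rotAvg f = c · rotAvg y^s
  have hfc : Continuous f := hf.continuous
  have hysc : Continuous ys := hysC2.continuous
  have havg : rotAvg f = fun w => c * rotAvg ys w := by
    funext w
    have h := hgavg w
    rw [hg, rotAvg_sub_const_mul hfc hysc c w] at h
    exact sub_eq_zero.mp h
  -- Lemma 1.11 twice and Theorem 1.16 on y^s
  have h1 := invariantOperator_rotAvg_I hk hfc
  have h2 := invariantOperator_rotAvg_I hk hysc
  have h3 : invariantOperator k ys UpperHalfPlane.I = selbergTransform k t := by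
    have := invariantOperator_im_cpow hk t UpperHalfPlane.I
    rw [UpperHalfPlane.I_im, Complex.ofReal_one, Complex.one_cpow, mul_one] at this
    rw [hys, hs]
    exact this
  rw [havg, invariantOperator_const_mul, h2, h3] at h1
  have hπ : (π : ℂ) ≠ 0 := by exact_mod_cast Real.pi_ne_zero
  have := mul_left_cancel₀ hπ (show (π : ℂ) * invariantOperator k f UpperHalfPlane.I =
    (π : ℂ) * (selbergTransform k t * c) by rw [← h1]; ring)
  rw [this]

/-- **Iwaniec, Theorems 1.14 and 1.16** (any eigenfunction of `Δ` is an eigenfunction of all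
invariant integral operators, with eigenvalue the Selberg/Harish-Chandra transform): if
`f ∈ C²(ℍ)` satisfies `(Δ + λ) f = 0` with `λ = s(1 - s) = 1/4 + t²`, `s = 1/2 + it`, `t ∈ ℂ`, and `k`
is a test kernel (bounded, compactly supported — the book takes `k ∈ C_0^∞(ℝ⁺)`), then
`∫_ℍ k(u(z, w)) f(w) dμ(w) = h(t) f(z)` for every `z ∈ ℍ`. Proof as in the book: by transitivity
reduce to `z = i`; the mean-value operator (Lemmas 1.10, 1.11); uniqueness of radial eigenfunctions
(Lemma 1.12 / Cor. 1.13, here via the divergence form of (1.20) and Gronwall instead of the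
hypergeometric equation); the value `h(t)` from `f = y^s` (`invariantOperator_im_cpow`).
[cite: Iwaniec2002, Thm 1.14 (1.60) & Thm 1.16, PDF pp. 23–24] -/
theorem invariantOperator_eigenfunction (hk : IsTestKernel k) (hf : IsC2 f) (t : ℂ)
    (heig : ∀ z, hypLaplacian f z + (1 / 4 + t ^ 2) * f z = 0) (z : ℍ) :
    invariantOperator k f z = selbergTransform k t * f z := by
  obtain ⟨σ, hσ⟩ := MulAction.exists_smul_eq SL(2, ℝ) UpperHalfPlane.I z
  set f' : ℍ → ℂ := fun w => f (σ • w) with hf'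
  have hσdet : 0 < ((Matrix.SpecialLinearGroup.toGL σ : GL (Fin 2) ℝ)).det.val := by simp
  have hf'C2 : IsC2 f' := IsC2.comp_smul hσdet hf
  have hf'eig : ∀ w, hypLaplacian f' w + (1 / 4 + t ^ 2) * f' w = 0 := by
    intro w
    have hcd : ContDiffAt ℝ 2 (f ∘ ofComplex)
        ((((Matrix.SpecialLinearGroup.toGL σ : GL (Fin 2) ℝ)) • w : ℍ) : ℂ) :=
      hf.contDiffAt (isOpen_upperHalfPlaneSet.mem_nhds
        (((Matrix.SpecialLinearGroup.toGL σ : GL (Fin 2) ℝ)) • w).im_pos)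
    have h := hypLaplacian_comp_smul hσdet f w hcd
    have e1 : (fun w : ℍ => f (((Matrix.SpecialLinearGroup.toGL σ : GL (Fin 2) ℝ)) • w)) = fun w => f (σ • w) := rfl
    rw [show ((Matrix.SpecialLinearGroup.toGL σ : GL (Fin 2) ℝ)) • w = σ • w from rfl, e1] at h
    rw [hf']
    simp only
    rw [h]
    exact heig (σ • w)
  have h := invariantOperator_eigenfunction_I hk hf'C2 t hf'eig
  rw [hf'] at h
  simp only at h
  rw [invariantOperator_comp_smul k f σ, hσ] at h
  exact h

end Theorem116

end Literature.NumberTheory.Automorphic
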